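import Literature.NumberTheory.LFunctions.KloostermanFractionsFromOffTools
import Literature.NumberTheory.LFunctions.KloostermanFractionsOffDiagO
import Literature.NumberTheory.LFunctions.KloostermanFractionsAmplifiedFormIoc
import Literature.NumberTheory.LFunctions.KloostermanFractionsFromCbTools
import HarnessLib

/-!
# Bilinear forms with Kloosterman fractions: from the explicit off-diagonal bound to (5.1'')

Topic `NumberTheory/LFunctions`.  S. Bettin, V. Chandee, Adv. Math. 328 (2018), §§2–5, with the
tree's EXPLICIT off-diagonal bound `kfO_le` (`KloostermanFractionsOffDiagO.lean`, an `A = 1`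
rendering of §4 in which the prime `ℓ₂` is kept outside Cauchy–Schwarz) in place of (4.33).  This
file PROVES, unconditionally:

* `BC_offO_of_kfO` — `kfO_le` in `ε`-form: for squarefree `γ` on `(N', 2N']` coprime to `bk`,
  `2 ≤ L ≤ M`, `1 ≤ N'`, an admissible amplifier set `𝓛`,
  `‖∑_{m∼M,(m,b)=1} kfOff m‖ ≪ ‖γ‖² x^{12δ} W (LN' + LM + b^{1/2}L^{3/2}N' + b^{1/2}L³N'^{3/2}/M + b^{1/2}L^{7/2}N'^{7/4}/M)`
  (`x = bMN'(1+|k|)`, `W = (1+|k|/(bN'M))^{1/2}`, divisor bound `τ(w) ≤ C₁w^δ`); compared with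
  (4.33) the third term carries an extra `L^{1/2}`;
* `BC_L_bound_of_offO` — with the amplifier (2.2) (`kfCI_le_diag_add_off`, `BC_card_amplifier_ge`)
  and the diagonal bound (3.2) (`BC_diag_51`), any such `O`-shape bound gives, for every real
  `L ≥ Lmin(b,M,N',k)` (logarithmic threshold), the four-term bound
  `∑_{m∼M,(m,b)=1}|kfInner m|² ≪ ‖γ‖² x^ε W (M²/L + b^{1/2}MN'L^{-1/2} + b^{1/2}LN'^{3/2} + b^{1/2}L^{3/2}N'^{7/4})`
  ((5.1''); `BC_offO_51`, `BC_amplifiedO_51`, and the trivial bound for `L > M`).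

The optimisation in `L` is `KloostermanFractionsFrom51O.lean`, §6 is `KloostermanFractionsFromCbO.lean`,
and the passage to Duke–Friedlander–Iwaniec's Proposition is `KloostermanFractionsGenericC1.lean`.

## References

* S. Bettin, V. Chandee, Adv. Math. 328 (2018) 1234–1262 (arXiv:1502.00769), §2 (2.2), §3 (3.2),
  §4.3 (4.33), §5 (5.1). [BettinChandee2018]
* W. Duke, J. Friedlander, H. Iwaniec, Invent. Math. 128 (1997) 23–43, §§3–5.
  [DukeFriedlanderIwaniec1997]
-/

noncomputable section

open Finset

namespace Literature.NumberTheory.LFunctions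


set_option maxHeartbeats 1600000 in
/-- **The explicit off-diagonal bound `kfO_le` in `ε`-form.**  For squarefree `γ` supported on
`n ∈ (N', 2N']` coprime to `bk`, `(b, k) = 1`, `k ≠ 0`, `1 ≤ N'`, `1/2 ≤ M`, `2 ≤ L ≤ M` and a set
`𝓛` of primes in `(L, 2L]` coprime to `bk`, the bound `kfO_le` of
`KloostermanFractionsOffDiagO.lean` (with the divisor bound `τ(w) ≤ C₁ w^δ`, `M₁ = ⌊M⌋`,
`M₂ = ⌊2M⌋`) gives
`‖∑_{M<m≤2M,(m,b)=1} kfOff m‖ ≤ C ‖γ‖² x^{12δ} W (LN' + LM + b^{1/2}L^{3/2}N' + b^{1/2}L³N'^{3/2}/M + b^{1/2}L^{7/2}N'^{7/4}/M)`,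
`x = bMN'(1+|k|)`, `W = (1 + |k|/(bN'M))^{1/2}`, with `C` explicit in `C₁, δ`.
[cite: BettinChandee2018, §4.3 (4.33)] -/
theorem BC_offO_of_kfO {δ : ℝ} (hδ : 0 < δ) (hδ1 : δ ≤ 1) {C₁ : ℝ} (hC₁ : 1 ≤ C₁)
    (hτ : ∀ n : ℕ, n ≠ 0 → ((n.divisors.card : ℕ) : ℝ) ≤ C₁ * (n : ℝ) ^ δ)
    {b : ℕ} (hb : 0 < b) {M N' : ℝ} (hM : 1 / 2 ≤ M) (hN1 : 1 ≤ N') {k : ℤ} (hk : k ≠ 0)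
    {γ : ℕ → ℂ} (hγ : ∀ n, γ n ≠ 0 → N' < n ∧ (n : ℝ) ≤ 2 * N')
    (hγ2 : ∀ n, γ n ≠ 0 → Squarefree n ∧ n.Coprime b ∧ n.Coprime k.natAbs)
    {L : ℕ} (hL2 : 2 ≤ L) (hLM : (L : ℝ) ≤ M) (𝓛 : Finset ℕ)
    (h𝓛 : ∀ ℓ ∈ 𝓛, ℓ.Prime ∧ L < ℓ ∧ ℓ ≤ 2 * L ∧ ℓ.Coprime b ∧ ℓ.Coprime k.natAbs) :
    ‖∑ m ∈ (Ioc ⌊M⌋₊ ⌊2 * M⌋₊).filter (fun m => m.Coprime b), kfOff k b N' γ 𝓛 m‖ ≤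
      (400 * C₁ * (1 + 16 / δ) + 60000 * C₁ ^ 2 + 2400 * C₁ +
          200 * C₁ * Real.sqrt (6144 * (200 * C₁) ^ 2 * (64 * Real.pi) * (9 + 4800 * C₁ * (1 + 1 / δ)))) *
        (∑ n ∈ Icc 1 ⌊2 * N'⌋₊, ‖γ n‖ ^ 2) * ((b : ℝ) * M * N' * (1 + |(k : ℝ)|)) ^ (12 * δ) *
        (1 + |(k : ℝ)| / ((b : ℝ) * N' * M)) ^ (1 / 2 : ℝ) *
        ((L : ℝ) * N' + (L : ℝ) * M + (b : ℝ) ^ (1 / 2 : ℝ) * (L : ℝ) ^ (3 / 2 : ℝ) * N' +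
          (b : ℝ) ^ (1 / 2 : ℝ) * (L : ℝ) ^ (3 : ℝ) * N' ^ (3 / 2 : ℝ) * M⁻¹ +
          (b : ℝ) ^ (1 / 2 : ℝ) * (L : ℝ) ^ (7 / 2 : ℝ) * N' ^ (7 / 4 : ℝ) * M⁻¹) := by
  -- sizes
  set S₂ : ℝ := ∑ n ∈ Icc 1 ⌊2 * N'⌋₊, ‖γ n‖ ^ 2 with hS₂
  set x : ℝ := (b : ℝ) * M * N' * (1 + |(k : ℝ)|) with hx
  set W : ℝ := (1 + |(k : ℝ)| / ((b : ℝ) * N' * M)) ^ (1 / 2 : ℝ) with hW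
  have hS0 : 0 ≤ S₂ := Finset.sum_nonneg fun _ _ => sq_nonneg _
  have hbr : (1 : ℝ) ≤ b := by exact_mod_cast hb
  have hb0 : (0 : ℝ) < b := by linarith
  have hM0 : 0 < M := by linarith
  have hN0 : 0 < N' := by linarith
  have hk1 : (1 : ℝ) ≤ |(k : ℝ)| := by
    rw [← Int.cast_abs]; exact_mod_cast Int.one_le_abs hk
  have hk0 : (0 : ℝ) ≤ |(k : ℝ)| := abs_nonneg _
  have hLr : (2 : ℝ) ≤ L := by exact_mod_cast hL2
  have hL0 : (0 : ℝ) < L := by linarith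
  have hL1 : (1 : ℝ) ≤ L := by linarith
  have hk2 : (2 : ℝ) ≤ 1 + |(k : ℝ)| := by linarith
  have hbN1 : (1 : ℝ) ≤ b * N' := by
    have := mul_le_mul hbr hN1 zero_le_one (by positivity)
    simpa using this
  have hMx : M ≤ x := by
    have h1 : (1 : ℝ) * M * 1 * 2 ≤ (b : ℝ) * M * N' * (1 + |(k : ℝ)|) := by gcongr
    rw [hx]; linarith
  have hx1 : 1 ≤ x := by
    have h1 : (1 : ℝ) * (1 / 2) * 1 * 2 ≤ (b : ℝ) * M * N' * (1 + |(k : ℝ)|) := by gcongr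
    rw [hx]; linarith
  have hx0 : 0 < x := by linarith
  have hN'x : N' ≤ x := by
    have h1 : (1 : ℝ) * (1 / 2) * N' * 2 ≤ (b : ℝ) * M * N' * (1 + |(k : ℝ)|) := by gcongr
    rw [hx]; linarith
  have hbN'x : (b : ℝ) * N' ≤ x := by
    have h1 : (b : ℝ) * (1 / 2) * N' * 2 ≤ (b : ℝ) * M * N' * (1 + |(k : ℝ)|) := by gcongr
    rw [hx]; linarith
  have hLx : (L : ℝ) ≤ x := hLM.trans hMx
  have hW1 : 1 ≤ W := Real.one_le_rpow (by
    have : 0 ≤ |(k : ℝ)| / ((b : ℝ) * N' * M) := by positivity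
    linarith) (by norm_num)
  have hW0 : 0 ≤ W := by linarith
  -- powers of `x`
  have hxpow : ∀ a : ℝ, 0 ≤ a → 1 ≤ x ^ a := fun a ha => Real.one_le_rpow hx1 ha
  have hxmono : ∀ a c : ℝ, a ≤ c → x ^ a ≤ x ^ c := fun a c hac =>
    Real.rpow_le_rpow_of_exponent_le hx1 hac
  -- the divisor parameter
  set M₁ : ℕ := ⌊M⌋₊ with hM₁
  set M₂ : ℕ := ⌊2 * M⌋₊ with hM₂
  have hM12 : M₁ ≤ M₂ := Nat.floor_le_floor (by linarith)
  have hM₁M : M ≤ (M₁ : ℝ) + 1 := (Nat.lt_floor_add_one M).le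
  have hM₁M' : (M₁ : ℝ) ≤ M := Nat.floor_le hM0.le
  have hM₂M : (M₂ : ℝ) ≤ 2 * M := Nat.floor_le (by linarith)
  set Y : ℝ := 16 * (L : ℝ) ^ 2 * (N' + (⌈4 * (L : ℝ) * N' / ((M₁ : ℝ) + 1)⌉₊ : ℝ)) + 2 * b * N'
    with hY
  have hceil : (⌈4 * (L : ℝ) * N' / ((M₁ : ℝ) + 1)⌉₊ : ℝ) ≤ 8 * L * N' + 1 := by
    have h1 : (⌈4 * (L : ℝ) * N' / ((M₁ : ℝ) + 1)⌉₊ : ℝ) < 4 * (L : ℝ) * N' / ((M₁ : ℝ) + 1) + 1 :=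
      Nat.ceil_lt_add_one (by positivity)
    have h2 : 4 * (L : ℝ) * N' / ((M₁ : ℝ) + 1) ≤ 8 * L * N' := by
      rw [div_le_iff₀ (by positivity)]
      have hM12' : (1 / 2 : ℝ) ≤ (M₁ : ℝ) + 1 := by linarith
      have := mul_le_mul_of_nonneg_left hM12' (by positivity : (0 : ℝ) ≤ 8 * L * N')
      linarith
    linarith
  have hY1 : 1 ≤ Y := by
    have : 0 ≤ 16 * (L : ℝ) ^ 2 * (N' + (⌈4 * (L : ℝ) * N' / ((M₁ : ℝ) + 1)⌉₊ : ℝ)) := by positivity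
    have h2 : (2 : ℝ) ≤ 2 * b * N' := by linarith
    rw [hY]; linarith
  have hY0 : 0 < Y := by linarith
  have hYx : Y ≤ 200 * x ^ (4 : ℝ) := by
    have hx4 : x ^ (4 : ℝ) = x ^ (4 : ℕ) := by
      rw [show (4 : ℝ) = ((4 : ℕ) : ℝ) by norm_num, Real.rpow_natCast]
    rw [hx4, hY]
    have h1 : 16 * (L : ℝ) ^ 2 * (N' + (⌈4 * (L : ℝ) * N' / ((M₁ : ℝ) + 1)⌉₊ : ℝ)) ≤
        16 * (L : ℝ) ^ 2 * (N' + (8 * L * N' + 1)) := by gcongr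
    have hx2 : (L : ℝ) ^ 2 ≤ x ^ 2 := pow_le_pow_left₀ hL0.le hLx 2
    have hx24 : x ^ 2 ≤ x ^ 4 := pow_le_pow_right₀ hx1 (by norm_num)
    have hx34 : x ^ 3 ≤ x ^ 4 := pow_le_pow_right₀ hx1 (by norm_num)
    have hx14 : x ≤ x ^ 4 := by
      calc x = x ^ 1 := (pow_one x).symm
        _ ≤ x ^ 4 := pow_le_pow_right₀ hx1 (by norm_num)
    have a1 : (L : ℝ) ^ 2 * N' ≤ x ^ 4 := by
      calc (L : ℝ) ^ 2 * N' ≤ x ^ 2 * x := mul_le_mul hx2 hN'x hN0.le (by positivity)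
        _ = x ^ 3 := by ring
        _ ≤ x ^ 4 := hx34
    have a2 : (L : ℝ) ^ 2 * (L * N') ≤ x ^ 4 := by
      have hLN : (L : ℝ) * N' ≤ x * x := mul_le_mul hLx hN'x hN0.le hx0.le
      calc (L : ℝ) ^ 2 * (L * N') ≤ x ^ 2 * (x * x) := mul_le_mul hx2 hLN (by positivity) (by positivity)
        _ = x ^ 4 := by ring
    have a3 : (L : ℝ) ^ 2 ≤ x ^ 4 := hx2.trans hx24
    have a4 : (b : ℝ) * N' ≤ x ^ 4 := hbN'x.trans hx14
    linarith
  set T' : ℝ := C₁ * Y ^ δ with hT'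
  have hC0 : 0 ≤ C₁ := by linarith
  have hT'1 : 1 ≤ T' := by
    have : (1 : ℝ) ≤ Y ^ δ := Real.one_le_rpow hY1 hδ.le
    rw [hT']
    calc (1 : ℝ) = 1 * 1 := (mul_one 1).symm
      _ ≤ C₁ * Y ^ δ := mul_le_mul hC₁ this zero_le_one hC0
  have hT'0 : 0 ≤ T' := by linarith
  have hT'x : T' ≤ 200 * C₁ * x ^ (4 * δ) := by
    have h1 : Y ^ δ ≤ (200 * x ^ (4 : ℝ)) ^ δ := Real.rpow_le_rpow hY0.le hYx hδ.le
    rw [Real.mul_rpow (by norm_num) (by positivity), ← Real.rpow_mul hx0.le] at h1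
    have h2 : (200 : ℝ) ^ δ ≤ 200 := by
      calc (200 : ℝ) ^ δ ≤ 200 ^ (1 : ℝ) := Real.rpow_le_rpow_of_exponent_le (by norm_num) hδ1
        _ = 200 := Real.rpow_one _
    have h3 : (200 : ℝ) ^ δ * x ^ (4 * δ) ≤ 200 * x ^ (4 * δ) :=
      mul_le_mul_of_nonneg_right h2 (by positivity)
    rw [hT']
    calc C₁ * Y ^ δ ≤ C₁ * (200 * x ^ (4 * δ)) := mul_le_mul_of_nonneg_left (h1.trans h3) hC0
      _ = 200 * C₁ * x ^ (4 * δ) := by ring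
  -- hypotheses of `kfO_le`
  have hγ' : ∀ n, γ n ≠ 0 → N' < n ∧ n.Coprime b ∧ Int.gcd k n = 1 ∧ Squarefree n := by
    intro n hn
    obtain ⟨hsq, hnb, hnk⟩ := hγ2 n hn
    refine ⟨(hγ n hn).1, hnb, ?_, hsq⟩
    show k.natAbs.gcd (n : ℤ).natAbs = 1
    rw [Int.natAbs_natCast]; exact hnk.symm
  have h𝓛' : ∀ ℓ ∈ 𝓛, ℓ.Prime ∧ L < ℓ ∧ ℓ ≤ 2 * L ∧ ℓ.Coprime b ∧ Int.gcd k ℓ = 1 := by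
    intro ℓ hℓ
    obtain ⟨h1, h2, h3, h4, h5⟩ := h𝓛 ℓ hℓ
    refine ⟨h1, h2, h3, h4, ?_⟩
    show k.natAbs.gcd (ℓ : ℤ).natAbs = 1
    rw [Int.natAbs_natCast]; exact h5.symm
  have hτY : ∀ w : ℕ, 1 ≤ w → (w : ℝ) ≤ Y → ((w.divisors.card : ℕ) : ℝ) ≤ T' := by
    intro w hw hwY
    have := hτ w (by omega)
    refine this.trans ?_
    rw [hT']
    exact mul_le_mul_of_nonneg_left (Real.rpow_le_rpow (by positivity) hwY hδ.le) hC0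
  have hγτ : ∀ n, γ n ≠ 0 → ((n.divisors.card : ℕ) : ℝ) ≤ T' := by
    intro n hn
    obtain ⟨hn1, hn2⟩ := hγ n hn
    have hn0 : 1 ≤ n := by
      by_contra h
      push Not at h
      interval_cases n
      simp at hn1; linarith
    refine hτY n hn0 (hn2.trans ?_)
    rw [hY]
    have : 0 ≤ 16 * (L : ℝ) ^ 2 * (N' + (⌈4 * (L : ℝ) * N' / ((M₁ : ℝ) + 1)⌉₊ : ℝ)) := by positivity
    have h2 : (2 : ℝ) * N' ≤ 2 * b * N' := by
      have := mul_le_mul_of_nonneg_right (by linarith : (2 : ℝ) ≤ 2 * b) hN0.le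
      linarith
    linarith
  have hO := kfO_le k hb γ (by linarith : (1 : ℝ) / 2 ≤ N') hγ' hL2 𝓛 h𝓛' hM12 hγτ hτY
  -- name the pieces of the explicit bound
  set R : ℝ := Real.log (2 * N') / Real.log L with hR
  set A₁ : ℝ := 32 * (L : ℝ) ^ 2 * N' ^ 2 * (((M₂ : ℝ) - M₁) / L + 1) / ((M₁ : ℝ) + 1) with hA₁
  set A₂ : ℝ := 6144 * T' ^ 2 * (L : ℝ) ^ 4 * N' ^ 3 *
      (1 + 64 * Real.pi * |(k : ℝ)| / ((b : ℝ) * ((M₁ : ℝ) + 1) * N')) *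
      (9 + T' * L * Real.sqrt (8 * N') * (1 + Real.log (8 * (L : ℝ) ^ 2 * N'))) /
      ((M₁ : ℝ) + 1) ^ 2 with hA₂
  -- (i) the degenerate part
  have hcard : (𝓛.card : ℝ) ≤ L := by
    have hsub : 𝓛 ⊆ Ioc L (2 * L) := by
      intro ℓ hℓ
      rw [Finset.mem_Ioc]
      exact ⟨(h𝓛 ℓ hℓ).2.1, (h𝓛 ℓ hℓ).2.2.1⟩
    have := Finset.card_le_card hsub
    rw [Nat.card_Ioc] at this
    have h' : 𝓛.card ≤ L := by omega
    exact_mod_cast h'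
  have hRx : R ≤ 4 / δ * x ^ δ := by
    have h1 : R ≤ 2 / δ * (2 * N') ^ δ := BC_log_div_log_le hδ (by linarith) hLr
    have h2 : (2 * N') ^ δ ≤ (2 * x) ^ δ := Real.rpow_le_rpow (by positivity) (by linarith) hδ.le
    rw [Real.mul_rpow (by norm_num) hx0.le] at h2
    have h2δ : (2 : ℝ) ^ δ ≤ 2 := by
      calc (2 : ℝ) ^ δ ≤ 2 ^ (1 : ℝ) := Real.rpow_le_rpow_of_exponent_le (by norm_num) hδ1
        _ = 2 := Real.rpow_one 2
    have h3 : (2 : ℝ) ^ δ * x ^ δ ≤ 2 * x ^ δ := mul_le_mul_of_nonneg_right h2δ (by positivity)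
    calc R ≤ 2 / δ * (2 * N') ^ δ := h1
      _ ≤ 2 / δ * (2 * x ^ δ) := mul_le_mul_of_nonneg_left (h2.trans h3) (by positivity)
      _ = 4 / δ * x ^ δ := by ring
  have hR0 : 0 ≤ R := div_nonneg (Real.log_nonneg (by linarith)) (Real.log_nonneg hL1)
  have hdeg : T' * ((𝓛.card : ℝ) * (2 * N') * (1 + 4 * R)) ≤
      400 * C₁ * (1 + 16 / δ) * x ^ (5 * δ) * ((L : ℝ) * N') := by
    have h1 : 1 + 4 * R ≤ (1 + 16 / δ) * x ^ δ := by
      have := hxpow δ hδ.le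
      have h4 : 4 * R ≤ 16 / δ * x ^ δ := by
        have := mul_le_mul_of_nonneg_left hRx (by norm_num : (0 : ℝ) ≤ 4)
        calc 4 * R ≤ 4 * (4 / δ * x ^ δ) := this
          _ = 16 / δ * x ^ δ := by ring
      have e : (1 + 16 / δ) * x ^ δ = x ^ δ + 16 / δ * x ^ δ := by ring
      rw [e]; linarith
    have h2 : (𝓛.card : ℝ) * (2 * N') * (1 + 4 * R) ≤ L * (2 * N') * ((1 + 16 / δ) * x ^ δ) := by
      have : (𝓛.card : ℝ) * (2 * N') ≤ L * (2 * N') := mul_le_mul_of_nonneg_right hcard (by positivity)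
      exact mul_le_mul this h1 (by positivity) (by positivity)
    have hx5 : x ^ (4 * δ) * x ^ δ = x ^ (5 * δ) := by rw [← Real.rpow_add hx0]; ring_nf
    calc T' * ((𝓛.card : ℝ) * (2 * N') * (1 + 4 * R))
        ≤ (200 * C₁ * x ^ (4 * δ)) * (L * (2 * N') * ((1 + 16 / δ) * x ^ δ)) :=
          mul_le_mul hT'x h2 (by positivity) (by positivity)
      _ = 400 * C₁ * (1 + 16 / δ) * (x ^ (4 * δ) * x ^ δ) * ((L : ℝ) * N') := by ring
      _ = _ := by rw [hx5]
  -- (ii) the trivial-`𝒮` part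
  have htrivS : T' * (T' * L * ((M₁ : ℝ) + 1) / 2) ≤ 60000 * C₁ ^ 2 * x ^ (8 * δ) * ((L : ℝ) * M) := by
    have h1 : (M₁ : ℝ) + 1 ≤ 3 * M := by linarith
    have hT2 : T' * T' ≤ (200 * C₁ * x ^ (4 * δ)) * (200 * C₁ * x ^ (4 * δ)) :=
      mul_le_mul hT'x hT'x hT'0 (by positivity)
    have hx8 : x ^ (4 * δ) * x ^ (4 * δ) = x ^ (8 * δ) := by rw [← Real.rpow_add hx0]; ring_nf
    calc T' * (T' * L * ((M₁ : ℝ) + 1) / 2) = (T' * T') * L * ((M₁ : ℝ) + 1) / 2 := by ring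
      _ ≤ ((200 * C₁ * x ^ (4 * δ)) * (200 * C₁ * x ^ (4 * δ))) * L * (3 * M) / 2 := by
          gcongr
      _ = 60000 * C₁ ^ 2 * (x ^ (4 * δ) * x ^ (4 * δ)) * ((L : ℝ) * M) := by ring
      _ = _ := by rw [hx8]
  -- (iii) the square root: `A₁ ≤ 128 L N'²`
  have hA₁le : A₁ ≤ 128 * L * N' ^ 2 := by
    have h1 : ((M₂ : ℝ) - M₁) / L + 1 ≤ 4 * M / L := by
      rw [div_add_one hL0.ne', div_le_div_iff_of_pos_right hL0]
      linarith
    have h1' : 0 ≤ ((M₂ : ℝ) - M₁) / L + 1 := by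
      have : (M₁ : ℝ) ≤ M₂ := by exact_mod_cast hM12
      positivity
    have h2 : A₁ ≤ 32 * (L : ℝ) ^ 2 * N' ^ 2 * (4 * M / L) / ((M₁ : ℝ) + 1) := by
      rw [hA₁]
      apply div_le_div_of_nonneg_right _ (by positivity)
      exact mul_le_mul_of_nonneg_left h1 (by positivity)
    have h3 : 32 * (L : ℝ) ^ 2 * N' ^ 2 * (4 * M / L) / ((M₁ : ℝ) + 1) =
        128 * L * N' ^ 2 * (M / ((M₁ : ℝ) + 1)) := by
      field_simp
      norm_num
    have h4 : M / ((M₁ : ℝ) + 1) ≤ 1 := (div_le_one (by positivity)).mpr hM₁M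
    calc A₁ ≤ _ := h2
      _ = 128 * L * N' ^ 2 * (M / ((M₁ : ℝ) + 1)) := h3
      _ ≤ 128 * L * N' ^ 2 * 1 := mul_le_mul_of_nonneg_left h4 (by positivity)
      _ = 128 * L * N' ^ 2 := by ring
  -- `A₂ ≤ CA x^{15δ} W² L⁴ N'³ (1 + L √N') / M²`
  set CA : ℝ := 6144 * (200 * C₁) ^ 2 * (64 * Real.pi) * (9 + 4800 * C₁ * (1 + 1 / δ)) with hCA
  have hCA0 : 0 < CA := by positivity
  have hWt : 1 + 64 * Real.pi * |(k : ℝ)| / ((b : ℝ) * ((M₁ : ℝ) + 1) * N') ≤ 64 * Real.pi * W ^ 2 := by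
    have hW2 : W ^ 2 = 1 + |(k : ℝ)| / ((b : ℝ) * N' * M) := by
      rw [hW, ← Real.rpow_natCast, ← Real.rpow_mul (by positivity)]; norm_num
    rw [hW2]
    have hπ : (1 : ℝ) ≤ 64 * Real.pi := by have := Real.pi_gt_three; linarith
    have h1 : |(k : ℝ)| / ((b : ℝ) * ((M₁ : ℝ) + 1) * N') ≤ |(k : ℝ)| / ((b : ℝ) * N' * M) := by
      apply div_le_div_of_nonneg_left hk0 (by positivity)
      calc (b : ℝ) * N' * M ≤ (b : ℝ) * N' * ((M₁ : ℝ) + 1) := by gcongr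
        _ = (b : ℝ) * ((M₁ : ℝ) + 1) * N' := by ring
    have h2 : 0 ≤ |(k : ℝ)| / ((b : ℝ) * N' * M) := by positivity
    calc 1 + 64 * Real.pi * |(k : ℝ)| / ((b : ℝ) * ((M₁ : ℝ) + 1) * N')
        = 1 + 64 * Real.pi * (|(k : ℝ)| / ((b : ℝ) * ((M₁ : ℝ) + 1) * N')) := by ring
      _ ≤ 64 * Real.pi * 1 + 64 * Real.pi * (|(k : ℝ)| / ((b : ℝ) * N' * M)) := by
          have := mul_le_mul_of_nonneg_left h1 (by positivity : (0 : ℝ) ≤ 64 * Real.pi)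
          linarith
      _ = 64 * Real.pi * (1 + |(k : ℝ)| / ((b : ℝ) * N' * M)) := by ring
  have hL21 : (1 : ℝ) ≤ (L : ℝ) ^ 2 := one_le_pow₀ hL1
  have h8LN : (1 : ℝ) ≤ 8 * (L : ℝ) ^ 2 * N' := by
    have := mul_le_mul hL21 hN1 zero_le_one (by positivity)
    linarith
  have hG9 : 9 + T' * L * Real.sqrt (8 * N') * (1 + Real.log (8 * (L : ℝ) ^ 2 * N')) ≤
      (9 + 4800 * C₁ * (1 + 1 / δ)) * x ^ (7 * δ) * (1 + L * Real.sqrt N') := by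
    have h8 : Real.sqrt (8 * N') ≤ 3 * Real.sqrt N' := by
      rw [Real.sqrt_mul' _ hN0.le]
      have : Real.sqrt 8 ≤ 3 := by
        rw [Real.sqrt_le_iff]; norm_num
      exact mul_le_mul_of_nonneg_right this (Real.sqrt_nonneg _)
    have hlog : 1 + Real.log (8 * (L : ℝ) ^ 2 * N') ≤ (1 + 1 / δ) * (8 * x ^ (3 * δ)) := by
      have h2 := BC_one_add_log_le hδ h8LN
      have hx2 : (L : ℝ) ^ 2 ≤ x ^ 2 := pow_le_pow_left₀ hL0.le hLx 2
      have hle : 8 * (L : ℝ) ^ 2 * N' ≤ 8 * x ^ 3 := by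
        have := mul_le_mul hx2 hN'x hN0.le (by positivity)
        calc 8 * (L : ℝ) ^ 2 * N' = 8 * ((L : ℝ) ^ 2 * N') := by ring
          _ ≤ 8 * (x ^ 2 * x) := by linarith
          _ = 8 * x ^ 3 := by ring
      have h3 : (8 * (L : ℝ) ^ 2 * N') ^ δ ≤ (8 * x ^ 3) ^ δ :=
        Real.rpow_le_rpow (by positivity) hle hδ.le
      have e1 : (8 * x ^ 3) ^ δ = (8 : ℝ) ^ δ * x ^ (3 * δ) := by
        rw [Real.mul_rpow (by norm_num) (by positivity)]
        congr 1
        rw [← Real.rpow_natCast, ← Real.rpow_mul hx0.le]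
        norm_num
      rw [e1] at h3
      have h8δ : (8 : ℝ) ^ δ ≤ 8 := by
        calc (8 : ℝ) ^ δ ≤ 8 ^ (1 : ℝ) := Real.rpow_le_rpow_of_exponent_le (by norm_num) hδ1
          _ = 8 := Real.rpow_one _
      have h4 : (8 : ℝ) ^ δ * x ^ (3 * δ) ≤ 8 * x ^ (3 * δ) := mul_le_mul_of_nonneg_right h8δ (by positivity)
      have h0 : 0 ≤ 1 + 1 / δ := by positivity
      exact h2.trans (mul_le_mul_of_nonneg_left (h3.trans h4) h0)
    have hlog0 : 0 ≤ 1 + Real.log (8 * (L : ℝ) ^ 2 * N') := by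
      have : 0 ≤ Real.log (8 * (L : ℝ) ^ 2 * N') := Real.log_nonneg h8LN
      linarith
    have h1 : T' * L * Real.sqrt (8 * N') * (1 + Real.log (8 * (L : ℝ) ^ 2 * N')) ≤
        (200 * C₁ * x ^ (4 * δ)) * L * (3 * Real.sqrt N') * ((1 + 1 / δ) * (8 * x ^ (3 * δ))) := by
      have ha : T' * L * Real.sqrt (8 * N') ≤ (200 * C₁ * x ^ (4 * δ)) * L * (3 * Real.sqrt N') := by
        gcongr
      exact mul_le_mul ha hlog hlog0 (by positivity)
    have hx7 : x ^ (4 * δ) * x ^ (3 * δ) = x ^ (7 * δ) := by rw [← Real.rpow_add hx0]; ring_nf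
    have hx71 : 1 ≤ x ^ (7 * δ) := hxpow _ (by positivity)
    have hLs0 : 0 ≤ (L : ℝ) * Real.sqrt N' := by positivity
    calc 9 + T' * L * Real.sqrt (8 * N') * (1 + Real.log (8 * (L : ℝ) ^ 2 * N'))
        ≤ 9 + (200 * C₁ * x ^ (4 * δ)) * L * (3 * Real.sqrt N') * ((1 + 1 / δ) * (8 * x ^ (3 * δ))) := by
          linarith
      _ = 9 + 4800 * C₁ * (1 + 1 / δ) * (x ^ (4 * δ) * x ^ (3 * δ)) * ((L : ℝ) * Real.sqrt N') := by ring
      _ = 9 + 4800 * C₁ * (1 + 1 / δ) * x ^ (7 * δ) * ((L : ℝ) * Real.sqrt N') := by rw [hx7]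
      _ ≤ 9 * x ^ (7 * δ) * (1 + L * Real.sqrt N') +
          4800 * C₁ * (1 + 1 / δ) * x ^ (7 * δ) * (1 + (L : ℝ) * Real.sqrt N') := by
          have a1 : (9 : ℝ) ≤ 9 * x ^ (7 * δ) * (1 + L * Real.sqrt N') := by
            have hone : (1 : ℝ) ≤ x ^ (7 * δ) * (1 + L * Real.sqrt N') :=
              one_le_mul_of_one_le_of_one_le hx71 (by linarith)
            have := mul_le_mul_of_nonneg_left hone (by norm_num : (0 : ℝ) ≤ 9)
            linarith [this]
          have a2 : 4800 * C₁ * (1 + 1 / δ) * x ^ (7 * δ) * ((L : ℝ) * Real.sqrt N') ≤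
              4800 * C₁ * (1 + 1 / δ) * x ^ (7 * δ) * (1 + (L : ℝ) * Real.sqrt N') := by
            apply mul_le_mul_of_nonneg_left (by linarith) (by positivity)
          linarith
      _ = (9 + 4800 * C₁ * (1 + 1 / δ)) * x ^ (7 * δ) * (1 + L * Real.sqrt N') := by ring
  have hA₂le : A₂ ≤ CA * x ^ (15 * δ) * W ^ 2 * (L : ℝ) ^ 4 * N' ^ 3 * (1 + L * Real.sqrt N') / M ^ 2 := by
    have hT2 : T' ^ 2 ≤ (200 * C₁ * x ^ (4 * δ)) ^ 2 := pow_le_pow_left₀ hT'0 hT'x 2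
    have hnum : 6144 * T' ^ 2 * (L : ℝ) ^ 4 * N' ^ 3 *
        (1 + 64 * Real.pi * |(k : ℝ)| / ((b : ℝ) * ((M₁ : ℝ) + 1) * N')) *
        (9 + T' * L * Real.sqrt (8 * N') * (1 + Real.log (8 * (L : ℝ) ^ 2 * N'))) ≤
        6144 * (200 * C₁ * x ^ (4 * δ)) ^ 2 * (L : ℝ) ^ 4 * N' ^ 3 * (64 * Real.pi * W ^ 2) *
        ((9 + 4800 * C₁ * (1 + 1 / δ)) * x ^ (7 * δ) * (1 + L * Real.sqrt N')) := by
      have hpos1 : 0 ≤ 1 + 64 * Real.pi * |(k : ℝ)| / ((b : ℝ) * ((M₁ : ℝ) + 1) * N') := by positivity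
      have hpos2 : 0 ≤ 9 + T' * L * Real.sqrt (8 * N') * (1 + Real.log (8 * (L : ℝ) ^ 2 * N')) := by
        have : 0 ≤ Real.log (8 * (L : ℝ) ^ 2 * N') := Real.log_nonneg h8LN
        positivity
      have ha : 6144 * T' ^ 2 * (L : ℝ) ^ 4 * N' ^ 3 ≤ 6144 * (200 * C₁ * x ^ (4 * δ)) ^ 2 * (L : ℝ) ^ 4 * N' ^ 3 := by
        gcongr
      exact mul_le_mul (mul_le_mul ha hWt hpos1 (by positivity)) hG9 hpos2 (by positivity)
    have hden : 1 / ((M₁ : ℝ) + 1) ^ 2 ≤ 1 / M ^ 2 := by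
      apply div_le_div_of_nonneg_left (by norm_num) (by positivity)
      exact pow_le_pow_left₀ hM0.le hM₁M 2
    have hx15 : (x ^ (4 * δ)) ^ 2 * x ^ (7 * δ) = x ^ (15 * δ) := by
      rw [← Real.rpow_natCast, ← Real.rpow_mul hx0.le, ← Real.rpow_add hx0]; ring_nf
    rw [hA₂, div_eq_mul_one_div]
    have hnum0 : 0 ≤ 6144 * (200 * C₁ * x ^ (4 * δ)) ^ 2 * (L : ℝ) ^ 4 * N' ^ 3 * (64 * Real.pi * W ^ 2) *
        ((9 + 4800 * C₁ * (1 + 1 / δ)) * x ^ (7 * δ) * (1 + L * Real.sqrt N')) := by positivity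
    calc _ ≤ 6144 * (200 * C₁ * x ^ (4 * δ)) ^ 2 * (L : ℝ) ^ 4 * N' ^ 3 * (64 * Real.pi * W ^ 2) *
          ((9 + 4800 * C₁ * (1 + 1 / δ)) * x ^ (7 * δ) * (1 + L * Real.sqrt N')) * (1 / M ^ 2) :=
          mul_le_mul hnum hden (by positivity) hnum0
      _ = CA * ((x ^ (4 * δ)) ^ 2 * x ^ (7 * δ)) * W ^ 2 * (L : ℝ) ^ 4 * N' ^ 3 *
          (1 + L * Real.sqrt N') / M ^ 2 := by rw [hCA]; ring
      _ = _ := by rw [hx15]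
  -- the square root
  set V₁ : ℝ := 12 * Real.sqrt L * N' with hV₁
  set V₂ : ℝ := Real.sqrt CA * x ^ (8 * δ) * W * (L : ℝ) ^ 2 * N' ^ (3 / 2 : ℝ) *
    (1 + Real.sqrt L * N' ^ (1 / 4 : ℝ)) / M with hV₂
  have hV₁0 : 0 ≤ V₁ := by positivity
  have hV₂0 : 0 ≤ V₂ := by positivity
  have hsqL : Real.sqrt (L : ℝ) ^ 2 = L := Real.sq_sqrt hL0.le
  have hsqCA : Real.sqrt CA ^ 2 = CA := Real.sq_sqrt hCA0.le
  have hA₁V : A₁ ≤ V₁ ^ 2 := by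
    calc A₁ ≤ 128 * L * N' ^ 2 := hA₁le
      _ ≤ 144 * L * N' ^ 2 := by
          have : 0 ≤ (L : ℝ) * N' ^ 2 := by positivity
          linarith
      _ = V₁ ^ 2 := by rw [hV₁, mul_pow, mul_pow, hsqL]; ring
  have hA₂V : A₂ ≤ V₂ ^ 2 := by
    have hN32 : (N' ^ (3 / 2 : ℝ)) ^ 2 = N' ^ 3 := by
      rw [← Real.rpow_natCast, ← Real.rpow_mul hN0.le]; norm_num
    have hN14 : (N' ^ (1 / 4 : ℝ)) ^ 2 = Real.sqrt N' := by
      rw [← Real.rpow_natCast, ← Real.rpow_mul hN0.le, Real.sqrt_eq_rpow]; norm_num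
    have hx16 : (x ^ (8 * δ)) ^ 2 = x ^ (16 * δ) := by
      rw [← Real.rpow_natCast, ← Real.rpow_mul hx0.le]; ring_nf
    have hexp : x ^ (15 * δ) ≤ x ^ (16 * δ) := hxmono _ _ (by linarith)
    have hsq1 : 1 + L * Real.sqrt N' ≤ (1 + Real.sqrt L * N' ^ (1 / 4 : ℝ)) ^ 2 := by
      have e : (1 + Real.sqrt L * N' ^ (1 / 4 : ℝ)) ^ 2 =
          1 + 2 * (Real.sqrt L * N' ^ (1 / 4 : ℝ)) + Real.sqrt L ^ 2 * (N' ^ (1 / 4 : ℝ)) ^ 2 := by ring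
      rw [e, hsqL, hN14]
      have : 0 ≤ Real.sqrt L * N' ^ (1 / 4 : ℝ) := by positivity
      linarith
    have hV₂sq : V₂ ^ 2 = CA * x ^ (16 * δ) * W ^ 2 * (L : ℝ) ^ 4 * N' ^ 3 *
        (1 + Real.sqrt L * N' ^ (1 / 4 : ℝ)) ^ 2 / M ^ 2 := by
      rw [hV₂, div_pow]
      have : (Real.sqrt CA * x ^ (8 * δ) * W * (L : ℝ) ^ 2 * N' ^ (3 / 2 : ℝ) *
          (1 + Real.sqrt L * N' ^ (1 / 4 : ℝ))) ^ 2 =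
          Real.sqrt CA ^ 2 * (x ^ (8 * δ)) ^ 2 * W ^ 2 * ((L : ℝ) ^ 2) ^ 2 * (N' ^ (3 / 2 : ℝ)) ^ 2 *
          (1 + Real.sqrt L * N' ^ (1 / 4 : ℝ)) ^ 2 := by ring
      rw [this, hsqCA, hx16, hN32]
      ring
    rw [hV₂sq]
    refine hA₂le.trans ?_
    apply div_le_div_of_nonneg_right _ (by positivity)
    have h0 : 0 ≤ CA * W ^ 2 * (L : ℝ) ^ 4 * N' ^ 3 := by positivity
    calc CA * x ^ (15 * δ) * W ^ 2 * (L : ℝ) ^ 4 * N' ^ 3 * (1 + L * Real.sqrt N')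
        = (CA * W ^ 2 * (L : ℝ) ^ 4 * N' ^ 3) * (x ^ (15 * δ) * (1 + L * Real.sqrt N')) := by ring
      _ ≤ (CA * W ^ 2 * (L : ℝ) ^ 4 * N' ^ 3) * (x ^ (16 * δ) * (1 + Real.sqrt L * N' ^ (1 / 4 : ℝ)) ^ 2) := by
          apply mul_le_mul_of_nonneg_left _ h0
          exact mul_le_mul hexp hsq1 (by positivity) (by positivity)
      _ = CA * x ^ (16 * δ) * W ^ 2 * (L : ℝ) ^ 4 * N' ^ 3 * (1 + Real.sqrt L * N' ^ (1 / 4 : ℝ)) ^ 2 := by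
          ring
  have hsqrt : Real.sqrt ((L : ℝ) * b * ((L : ℝ) * (A₁ + A₂))) ≤ (L : ℝ) * Real.sqrt b * (V₁ + V₂) := by
    refine Real.sqrt_le_iff.mpr ⟨by positivity, ?_⟩
    have hsqb : Real.sqrt (b : ℝ) ^ 2 = b := Real.sq_sqrt hb0.le
    have e : ((L : ℝ) * Real.sqrt b * (V₁ + V₂)) ^ 2 = (L : ℝ) * b * ((L : ℝ) * (V₁ + V₂) ^ 2) := by
      rw [mul_pow, mul_pow, hsqb]; ring
    rw [e]
    apply mul_le_mul_of_nonneg_left _ (by positivity)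
    apply mul_le_mul_of_nonneg_left _ hL0.le
    have e : (V₁ + V₂) ^ 2 = V₁ ^ 2 + 2 * (V₁ * V₂) + V₂ ^ 2 := by ring
    rw [e]
    linarith [hA₁V, hA₂V, mul_nonneg hV₁0 hV₂0]
  -- (iii') the square-root part times `T'`
  have hsq_part : T' * Real.sqrt ((L : ℝ) * b * ((L : ℝ) * (A₁ + A₂))) ≤
      2400 * C₁ * x ^ (4 * δ) * ((b : ℝ) ^ (1 / 2 : ℝ) * (L : ℝ) ^ (3 / 2 : ℝ) * N') +
      200 * C₁ * Real.sqrt CA * x ^ (12 * δ) * W *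
        ((b : ℝ) ^ (1 / 2 : ℝ) * (L : ℝ) ^ (3 : ℝ) * N' ^ (3 / 2 : ℝ) * M⁻¹ +
          (b : ℝ) ^ (1 / 2 : ℝ) * (L : ℝ) ^ (7 / 2 : ℝ) * N' ^ (7 / 4 : ℝ) * M⁻¹) := by
    have hsb : Real.sqrt (b : ℝ) = (b : ℝ) ^ (1 / 2 : ℝ) := Real.sqrt_eq_rpow _
    have hsL : Real.sqrt (L : ℝ) = (L : ℝ) ^ (1 / 2 : ℝ) := Real.sqrt_eq_rpow _
    have hL32 : (L : ℝ) * (L : ℝ) ^ (1 / 2 : ℝ) = (L : ℝ) ^ (3 / 2 : ℝ) := by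
      rw [show (3 / 2 : ℝ) = 1 + 1 / 2 by norm_num, Real.rpow_add hL0, Real.rpow_one]
    have hL3' : (L : ℝ) ^ (3 : ℝ) = (L : ℝ) ^ 3 := by
      rw [show (3 : ℝ) = ((3 : ℕ) : ℝ) by norm_num, Real.rpow_natCast]
    have hL72' : (L : ℝ) ^ (7 / 2 : ℝ) = (L : ℝ) ^ 3 * (L : ℝ) ^ (1 / 2 : ℝ) := by
      rw [show (7 / 2 : ℝ) = ((3 : ℕ) : ℝ) + 1 / 2 by norm_num, Real.rpow_add hL0, Real.rpow_natCast]
    have hN74' : N' ^ (7 / 4 : ℝ) = N' ^ (3 / 2 : ℝ) * N' ^ (1 / 4 : ℝ) := by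
      rw [← Real.rpow_add hN0]; norm_num
    have hx12 : x ^ (4 * δ) * x ^ (8 * δ) = x ^ (12 * δ) := by rw [← Real.rpow_add hx0]; ring_nf
    -- expand `T' L √b (V₁ + V₂)`
    have h1 : T' * Real.sqrt ((L : ℝ) * b * ((L : ℝ) * (A₁ + A₂))) ≤ T' * ((L : ℝ) * Real.sqrt b * (V₁ + V₂)) :=
      mul_le_mul_of_nonneg_left hsqrt hT'0
    have h2 : T' * ((L : ℝ) * Real.sqrt b * (V₁ + V₂)) ≤
        (200 * C₁ * x ^ (4 * δ)) * ((L : ℝ) * Real.sqrt b * (V₁ + V₂)) :=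
      mul_le_mul_of_nonneg_right hT'x (by positivity)
    have e1 : (200 * C₁ * x ^ (4 * δ)) * ((L : ℝ) * Real.sqrt b * V₁) =
        2400 * C₁ * x ^ (4 * δ) * ((b : ℝ) ^ (1 / 2 : ℝ) * (L : ℝ) ^ (3 / 2 : ℝ) * N') := by
      rw [hV₁, hsb, hsL, ← hL32]; ring
    have e2 : (200 * C₁ * x ^ (4 * δ)) * ((L : ℝ) * Real.sqrt b * V₂) =
        200 * C₁ * Real.sqrt CA * x ^ (12 * δ) * W *
          ((b : ℝ) ^ (1 / 2 : ℝ) * (L : ℝ) ^ (3 : ℝ) * N' ^ (3 / 2 : ℝ) * M⁻¹ +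
            (b : ℝ) ^ (1 / 2 : ℝ) * (L : ℝ) ^ (7 / 2 : ℝ) * N' ^ (7 / 4 : ℝ) * M⁻¹) := by
      rw [hV₂, hsb, hsL, hL3', hL72', hN74', ← hx12]
      field_simp
    calc T' * Real.sqrt ((L : ℝ) * b * ((L : ℝ) * (A₁ + A₂)))
        ≤ (200 * C₁ * x ^ (4 * δ)) * ((L : ℝ) * Real.sqrt b * (V₁ + V₂)) := h1.trans h2
      _ = (200 * C₁ * x ^ (4 * δ)) * ((L : ℝ) * Real.sqrt b * V₁) +
          (200 * C₁ * x ^ (4 * δ)) * ((L : ℝ) * Real.sqrt b * V₂) := by ring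
      _ = _ := by rw [e1, e2]
  -- assemble
  have hOle : ‖∑ m ∈ (Ioc M₁ M₂).filter (fun m => m.Coprime b), kfOff k b N' γ 𝓛 m‖ ≤
      S₂ * (T' * ((𝓛.card : ℝ) * (2 * N') * (1 + 4 * R)) + T' * (T' * L * ((M₁ : ℝ) + 1) / 2) +
        T' * Real.sqrt ((L : ℝ) * b * ((L : ℝ) * (A₁ + A₂)))) := by
    calc _ ≤ _ := hO
      _ = _ := by rw [hS₂, hR, hA₁, hA₂]; ring
  refine hOle.trans ?_
  -- compare with the target, term by term
  set y := x ^ (12 * δ) with hy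
  have hy5 : x ^ (5 * δ) ≤ y := hxmono _ _ (by linarith)
  have hy8 : x ^ (8 * δ) ≤ y := hxmono _ _ (by linarith)
  have hy4 : x ^ (4 * δ) ≤ y := hxmono _ _ (by linarith)
  have hy0 : 0 ≤ y := by positivity
  set P₁ : ℝ := (L : ℝ) * N' with hP₁
  set P₂ : ℝ := (L : ℝ) * M with hP₂
  set P₃ : ℝ := (b : ℝ) ^ (1 / 2 : ℝ) * (L : ℝ) ^ (3 / 2 : ℝ) * N' with hP₃
  set P₄ : ℝ := (b : ℝ) ^ (1 / 2 : ℝ) * (L : ℝ) ^ (3 : ℝ) * N' ^ (3 / 2 : ℝ) * M⁻¹ with hP₄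
  set P₅ : ℝ := (b : ℝ) ^ (1 / 2 : ℝ) * (L : ℝ) ^ (7 / 2 : ℝ) * N' ^ (7 / 4 : ℝ) * M⁻¹ with hP₅
  have hP₁0 : 0 ≤ P₁ := by positivity
  have hP₂0 : 0 ≤ P₂ := by positivity
  have hP₃0 : 0 ≤ P₃ := by positivity
  have hP₄0 : 0 ≤ P₄ := by positivity
  have hP₅0 : 0 ≤ P₅ := by positivity
  set c₁ : ℝ := 400 * C₁ * (1 + 16 / δ) with hc₁
  set c₂ : ℝ := 60000 * C₁ ^ 2 with hc₂
  set c₃ : ℝ := 2400 * C₁ with hc₃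
  set c₄ : ℝ := 200 * C₁ * Real.sqrt CA with hc₄
  have hc₁0 : 0 ≤ c₁ := by positivity
  have hc₂0 : 0 ≤ c₂ := by positivity
  have hc₃0 : 0 ≤ c₃ := by positivity
  have hc₄0 : 0 ≤ c₄ := by positivity
  -- each piece ≤ cᵢ y W Pᵢ
  have t1 : c₁ * x ^ (5 * δ) * P₁ ≤ c₁ * y * W * P₁ := by
    have : x ^ (5 * δ) ≤ y * W := hy5.trans (le_mul_of_one_le_right hy0 hW1)
    calc c₁ * x ^ (5 * δ) * P₁ = c₁ * P₁ * x ^ (5 * δ) := by ring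
      _ ≤ c₁ * P₁ * (y * W) := mul_le_mul_of_nonneg_left this (by positivity)
      _ = c₁ * y * W * P₁ := by ring
  have t2 : c₂ * x ^ (8 * δ) * P₂ ≤ c₂ * y * W * P₂ := by
    have : x ^ (8 * δ) ≤ y * W := hy8.trans (le_mul_of_one_le_right hy0 hW1)
    calc c₂ * x ^ (8 * δ) * P₂ = c₂ * P₂ * x ^ (8 * δ) := by ring
      _ ≤ c₂ * P₂ * (y * W) := mul_le_mul_of_nonneg_left this (by positivity)
      _ = c₂ * y * W * P₂ := by ring
  have t3 : c₃ * x ^ (4 * δ) * P₃ ≤ c₃ * y * W * P₃ := by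
    have : x ^ (4 * δ) ≤ y * W := hy4.trans (le_mul_of_one_le_right hy0 hW1)
    calc c₃ * x ^ (4 * δ) * P₃ = c₃ * P₃ * x ^ (4 * δ) := by ring
      _ ≤ c₃ * P₃ * (y * W) := mul_le_mul_of_nonneg_left this (by positivity)
      _ = c₃ * y * W * P₃ := by ring
  have hsum : S₂ * (c₁ * x ^ (5 * δ) * P₁ + c₂ * x ^ (8 * δ) * P₂ +
      (c₃ * x ^ (4 * δ) * P₃ + c₄ * y * W * (P₄ + P₅))) ≤
      (c₁ + c₂ + c₃ + c₄) * S₂ * y * W * (P₁ + P₂ + P₃ + P₄ + P₅) := by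
    have step : c₁ * x ^ (5 * δ) * P₁ + c₂ * x ^ (8 * δ) * P₂ +
        (c₃ * x ^ (4 * δ) * P₃ + c₄ * y * W * (P₄ + P₅)) ≤
        (c₁ + c₂ + c₃ + c₄) * y * W * (P₁ + P₂ + P₃ + P₄ + P₅) := by
      have e : (c₁ + c₂ + c₃ + c₄) * y * W * (P₁ + P₂ + P₃ + P₄ + P₅) =
          c₁ * y * W * P₁ + c₂ * y * W * P₂ + c₃ * y * W * P₃ + c₄ * y * W * (P₄ + P₅) +
          (c₁ * (y * W) * (P₂ + P₃ + P₄ + P₅) + c₂ * (y * W) * (P₁ + P₃ + P₄ + P₅) +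
            c₃ * (y * W) * (P₁ + P₂ + P₄ + P₅) + c₄ * (y * W) * (P₁ + P₂ + P₃)) := by ring
      rw [e]
      have : 0 ≤ c₁ * (y * W) * (P₂ + P₃ + P₄ + P₅) + c₂ * (y * W) * (P₁ + P₃ + P₄ + P₅) +
          c₃ * (y * W) * (P₁ + P₂ + P₄ + P₅) + c₄ * (y * W) * (P₁ + P₂ + P₃) := by positivity
      linarith [t1, t2, t3]
    calc _ ≤ S₂ * ((c₁ + c₂ + c₃ + c₄) * y * W * (P₁ + P₂ + P₃ + P₄ + P₅)) :=
          mul_le_mul_of_nonneg_left step hS0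
      _ = _ := by ring
  refine le_trans ?_ hsum
  apply mul_le_mul_of_nonneg_left _ hS0
  have hsq_part' : T' * Real.sqrt ((L : ℝ) * b * ((L : ℝ) * (A₁ + A₂))) ≤
      c₃ * x ^ (4 * δ) * P₃ + c₄ * y * W * (P₄ + P₅) := by
    rw [hc₃, hc₄, hP₃, hP₄, hP₅, hy]; exact hsq_part
  linarith [hdeg, htrivS, hsq_part']


/-! ### The off-diagonal `O`-shape times the amplifier factor -/

/-- **The `O`-shape off-diagonal bound times `32 M (log L)²/L²`**: for `2 ≤ L ≤ M`, `1 ≤ N'`,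
`k ≠ 0`, `(32 M (log L)²/L²) · K S₂ x^{ε'} W (LN' + LM + b^{1/2}L^{3/2}N' + b^{1/2}L³N'^{3/2}/M + b^{1/2}L^{7/2}N'^{7/4}/M)`
`≤ (64K/δ²) S₂ x^{ε'+2δ} W (M²/L + b^{1/2}MN'L^{-1/2} + b^{1/2}LN'^{3/2} + b^{1/2}L^{3/2}N'^{7/4})`
(the term `MN'/L` being at most `b^{1/2}MN'L^{-1/2}`). [cite: BettinChandee2018, §5 (5.1)] -/
theorem BC_offO_51 {δ : ℝ} (hδ : 0 < δ) {b : ℕ} (hb : 0 < b) {M N' : ℝ} (hM : 1 / 2 ≤ M)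
    (hN1 : 1 ≤ N') {k : ℤ} (hk : k ≠ 0) {L : ℕ} (hL2 : 2 ≤ L) (hLM : (L : ℝ) ≤ M)
    {K S₂ W : ℝ} (ε' : ℝ) (hK : 0 ≤ K) (hS : 0 ≤ S₂) (hW : 0 ≤ W) :
    32 * M * Real.log L ^ 2 / (L : ℝ) ^ 2 *
      (K * S₂ * ((b : ℝ) * M * N' * (1 + |(k : ℝ)|)) ^ ε' * W *
        ((L : ℝ) * N' + (L : ℝ) * M + (b : ℝ) ^ (1 / 2 : ℝ) * (L : ℝ) ^ (3 / 2 : ℝ) * N' +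
          (b : ℝ) ^ (1 / 2 : ℝ) * (L : ℝ) ^ (3 : ℝ) * N' ^ (3 / 2 : ℝ) * M⁻¹ +
          (b : ℝ) ^ (1 / 2 : ℝ) * (L : ℝ) ^ (7 / 2 : ℝ) * N' ^ (7 / 4 : ℝ) * M⁻¹)) ≤
      64 * K / δ ^ 2 * S₂ * ((b : ℝ) * M * N' * (1 + |(k : ℝ)|)) ^ (ε' + 2 * δ) * W *
        (M ^ 2 / (L : ℝ) + (b : ℝ) ^ (1 / 2 : ℝ) * M * N' * (L : ℝ) ^ (-(1 / 2) : ℝ) +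
            (b : ℝ) ^ (1 / 2 : ℝ) * (L : ℝ) * N' ^ (3 / 2 : ℝ) + (b : ℝ) ^ (1 / 2 : ℝ) * (L : ℝ) ^ (3 / 2 : ℝ) * N' ^ (7 / 4 : ℝ)) := by
  set x : ℝ := ((b : ℝ) * M * N' * (1 + |(k : ℝ)|)) with hx
  have hbr : (1 : ℝ) ≤ b := by exact_mod_cast hb
  have hM0 : 0 < M := by linarith
  have hN0 : 0 < N' := by linarith
  have hk1 : (1 : ℝ) ≤ |(k : ℝ)| := by
    rw [← Int.cast_abs]; exact_mod_cast Int.one_le_abs hk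
  have hLr : (2 : ℝ) ≤ L := by exact_mod_cast hL2
  have hL0 : (0 : ℝ) < L := by linarith
  have hL1 : (1 : ℝ) ≤ L := by linarith
  have hbN1 : (1 : ℝ) ≤ b * N' := by nlinarith
  have hMx : M ≤ x := by
    have : M * 1 * 2 ≤ M * ((b : ℝ) * N') * (1 + |(k : ℝ)|) := by gcongr; linarith
    rw [hx]; nlinarith
  have hx0 : 0 < x := by linarith
  -- `(log L)² ≤ x^{2δ}/δ²`
  have hlogL2 : Real.log L ^ 2 ≤ x ^ (2 * δ) / δ ^ 2 := by
    have h1 := BC_log_sq_le hδ hL1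
    have h2 : (L : ℝ) ^ (2 * δ) ≤ x ^ (2 * δ) :=
      Real.rpow_le_rpow hL0.le (hLM.trans hMx) (by linarith)
    exact h1.trans (div_le_div_of_nonneg_right h2 (by positivity))
  -- monomial identities
  have hL12 : (L : ℝ) ^ (3 / 2 : ℝ) / L = (L : ℝ) ^ (1 / 2 : ℝ) := by
    rw [show (1 / 2 : ℝ) = 3 / 2 - 1 by norm_num, Real.rpow_sub_one hL0.ne']
  have hL3 : (L : ℝ) ^ (3 : ℝ) / L = (L : ℝ) ^ 2 := by
    rw [show (3 : ℝ) = ((3 : ℕ) : ℝ) by norm_num, Real.rpow_natCast]; field_simp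
  have hL72 : (L : ℝ) ^ (7 / 2 : ℝ) / L = (L : ℝ) ^ (5 / 2 : ℝ) := by
    rw [show (5 / 2 : ℝ) = 7 / 2 - 1 by norm_num, Real.rpow_sub_one hL0.ne']
  have hL52 : (L : ℝ) ^ (5 / 2 : ℝ) = (L : ℝ) * (L : ℝ) ^ (3 / 2 : ℝ) := by
    rw [show (5 / 2 : ℝ) = 1 + 3 / 2 by norm_num, Real.rpow_add hL0, Real.rpow_one]
  have hLm12 : (L : ℝ) ^ (1 / 2 : ℝ) / L = (L : ℝ) ^ (-(1 / 2) : ℝ) := by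
    rw [show (-(1 / 2) : ℝ) = 1 / 2 - 1 by norm_num, Real.rpow_sub_one hL0.ne']
  -- `M/L² · O5 = (five terms)/L`, i.e. the identities
  set Q : ℝ := ((L : ℝ) * N' + (L : ℝ) * M + (b : ℝ) ^ (1 / 2 : ℝ) * (L : ℝ) ^ (3 / 2 : ℝ) * N' +
          (b : ℝ) ^ (1 / 2 : ℝ) * (L : ℝ) ^ (3 : ℝ) * N' ^ (3 / 2 : ℝ) * M⁻¹ +
          (b : ℝ) ^ (1 / 2 : ℝ) * (L : ℝ) ^ (7 / 2 : ℝ) * N' ^ (7 / 4 : ℝ) * M⁻¹) with hQ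
  have hQ0 : 0 ≤ Q := by positivity
  have hid : M / (L : ℝ) ^ 2 * Q =
      M * N' / L + M ^ 2 / L + (b : ℝ) ^ (1 / 2 : ℝ) * M * N' * (L : ℝ) ^ (-(1 / 2) : ℝ) +
        (b : ℝ) ^ (1 / 2 : ℝ) * (L : ℝ) * N' ^ (3 / 2 : ℝ) +
        (b : ℝ) ^ (1 / 2 : ℝ) * (L : ℝ) ^ (3 / 2 : ℝ) * N' ^ (7 / 4 : ℝ) := by
    rw [hQ, ← hLm12, ← hL12]
    have e3 : (L : ℝ) ^ (3 : ℝ) = (L : ℝ) * (L : ℝ) ^ 2 := by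
      rw [show (3 : ℝ) = ((3 : ℕ) : ℝ) by norm_num, Real.rpow_natCast]; ring
    have e7 : (L : ℝ) ^ (7 / 2 : ℝ) = (L : ℝ) ^ 2 * (L : ℝ) ^ (3 / 2 : ℝ) := by
      rw [show (7 / 2 : ℝ) = ((2 : ℕ) : ℝ) + 3 / 2 by norm_num, Real.rpow_add hL0, Real.rpow_natCast]
    rw [e3, e7]
    field_simp
  -- the merged term `MN'/L ≤ b^{1/2} M N' L^{-1/2}`
  have hmerge : M * N' / L ≤ (b : ℝ) ^ (1 / 2 : ℝ) * M * N' * (L : ℝ) ^ (-(1 / 2) : ℝ) := by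
    have hb12 : (1 : ℝ) ≤ (b : ℝ) ^ (1 / 2 : ℝ) := Real.one_le_rpow hbr (by norm_num)
    have hLi : 1 / (L : ℝ) ≤ (L : ℝ) ^ (-(1 / 2) : ℝ) := by
      rw [Real.rpow_neg hL0.le, ← one_div]
      apply one_div_le_one_div_of_le (by positivity)
      calc (L : ℝ) ^ (1 / 2 : ℝ) ≤ (L : ℝ) ^ (1 : ℝ) :=
            Real.rpow_le_rpow_of_exponent_le hL1 (by norm_num)
        _ = L := Real.rpow_one _
    calc M * N' / L = 1 * (M * N') * (1 / L) := by ring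
      _ ≤ (b : ℝ) ^ (1 / 2 : ℝ) * (M * N') * (L : ℝ) ^ (-(1 / 2) : ℝ) :=
          mul_le_mul (mul_le_mul_of_nonneg_right hb12 (by positivity)) hLi (by positivity) (by positivity)
      _ = (b : ℝ) ^ (1 / 2 : ℝ) * M * N' * (L : ℝ) ^ (-(1 / 2) : ℝ) := by ring
  set T : ℝ := (M ^ 2 / (L : ℝ) + (b : ℝ) ^ (1 / 2 : ℝ) * M * N' * (L : ℝ) ^ (-(1 / 2) : ℝ) +
            (b : ℝ) ^ (1 / 2 : ℝ) * (L : ℝ) * N' ^ (3 / 2 : ℝ) + (b : ℝ) ^ (1 / 2 : ℝ) * (L : ℝ) ^ (3 / 2 : ℝ) * N' ^ (7 / 4 : ℝ)) with hT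
  have hT0 : 0 ≤ T := by positivity
  have hid2 : M / (L : ℝ) ^ 2 * Q ≤ 2 * T := by
    rw [hid, hT]
    have a1 : 0 ≤ M ^ 2 / (L : ℝ) := by positivity
    have a3 : 0 ≤ (b : ℝ) ^ (1 / 2 : ℝ) * (L : ℝ) * N' ^ (3 / 2 : ℝ) := by positivity
    have a4 : 0 ≤ (b : ℝ) ^ (1 / 2 : ℝ) * (L : ℝ) ^ (3 / 2 : ℝ) * N' ^ (7 / 4 : ℝ) := by positivity
    linarith [hmerge]
  have hre : 32 * M * Real.log L ^ 2 / (L : ℝ) ^ 2 * (K * S₂ * x ^ ε' * W * Q) =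
      32 * K * S₂ * x ^ ε' * W * Real.log L ^ 2 * (M / (L : ℝ) ^ 2 * Q) := by
    field_simp
  rw [hre]
  have hxe : x ^ (ε' + 2 * δ) = x ^ ε' * x ^ (2 * δ) := Real.rpow_add hx0 _ _
  rw [hxe]
  have h0 : 0 ≤ 32 * K * S₂ * x ^ ε' * W := by positivity
  have hMQ0 : 0 ≤ M / (L : ℝ) ^ 2 * Q := by positivity
  calc 32 * K * S₂ * x ^ ε' * W * Real.log L ^ 2 * (M / (L : ℝ) ^ 2 * Q)
      ≤ 32 * K * S₂ * x ^ ε' * W * (x ^ (2 * δ) / δ ^ 2) * (2 * T) :=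
        mul_le_mul (mul_le_mul_of_nonneg_left hlogL2 h0) hid2 hMQ0 (by positivity)
    _ = 64 * K / δ ^ 2 * S₂ * (x ^ ε' * x ^ (2 * δ)) * W * T := by
        field_simp
        ring

/-- The three diagonal terms of (5.1) are dominated by the four terms of the `O`-family:
`M(bN')^{1/2}L^{-1/2} + M²/(bLN') + M²/L ≤ 2 (M²/L + b^{1/2}MN'L^{-1/2} + b^{1/2}LN'^{3/2} + b^{1/2}L^{3/2}N'^{7/4})`
for `N' ≥ 1`, `b ≥ 1`. [folklore] -/
theorem BC_diag_terms_le_T4 {b : ℕ} (hb : 0 < b) {M N' L : ℝ} (hM : 0 < M) (hN1 : 1 ≤ N') (hL : 0 < L) :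
    M * ((b : ℝ) * N') ^ (1 / 2 : ℝ) * L ^ (-(1 / 2) : ℝ) + M ^ 2 / ((b : ℝ) * L * N') + M ^ 2 / L ≤
      2 * (M ^ 2 / L + (b : ℝ) ^ (1 / 2 : ℝ) * M * N' * L ^ (-(1 / 2) : ℝ) +
            (b : ℝ) ^ (1 / 2 : ℝ) * L * N' ^ (3 / 2 : ℝ) + (b : ℝ) ^ (1 / 2 : ℝ) * L ^ (3 / 2 : ℝ) * N' ^ (7 / 4 : ℝ)) := by
  have hbr : (1 : ℝ) ≤ b := by exact_mod_cast hb
  have hb0 : (0 : ℝ) < b := by linarith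
  have hN0 : 0 < N' := by linarith
  have h1 : ((b : ℝ) * N') ^ (1 / 2 : ℝ) ≤ (b : ℝ) ^ (1 / 2 : ℝ) * N' := by
    rw [Real.mul_rpow hb0.le hN0.le]
    apply mul_le_mul_of_nonneg_left _ (by positivity)
    calc N' ^ (1 / 2 : ℝ) ≤ N' ^ (1 : ℝ) := Real.rpow_le_rpow_of_exponent_le hN1 (by norm_num)
      _ = N' := Real.rpow_one _
  have t1 : M * ((b : ℝ) * N') ^ (1 / 2 : ℝ) * L ^ (-(1 / 2) : ℝ) ≤
      (b : ℝ) ^ (1 / 2 : ℝ) * M * N' * L ^ (-(1 / 2) : ℝ) := by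
    calc M * ((b : ℝ) * N') ^ (1 / 2 : ℝ) * L ^ (-(1 / 2) : ℝ)
        ≤ M * ((b : ℝ) ^ (1 / 2 : ℝ) * N') * L ^ (-(1 / 2) : ℝ) := by
          apply mul_le_mul_of_nonneg_right (mul_le_mul_of_nonneg_left h1 hM.le) (by positivity)
      _ = (b : ℝ) ^ (1 / 2 : ℝ) * M * N' * L ^ (-(1 / 2) : ℝ) := by ring
  have t2 : M ^ 2 / ((b : ℝ) * L * N') ≤ M ^ 2 / L := by
    apply div_le_div_of_nonneg_left (by positivity) hL
    have hbN1 : (1 : ℝ) ≤ b * N' := by nlinarith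
    calc L = L * 1 := (mul_one L).symm
      _ ≤ L * ((b : ℝ) * N') := mul_le_mul_of_nonneg_left hbN1 hL.le
      _ = (b : ℝ) * L * N' := by ring
  have a3 : 0 ≤ (b : ℝ) ^ (1 / 2 : ℝ) * L * N' ^ (3 / 2 : ℝ) := by positivity
  have a4 : 0 ≤ (b : ℝ) ^ (1 / 2 : ℝ) * L ^ (3 / 2 : ℝ) * N' ^ (7 / 4 : ℝ) := by positivity
  have a1 : 0 ≤ M ^ 2 / L := by positivity
  have a2 : 0 ≤ (b : ℝ) ^ (1 / 2 : ℝ) * M * N' * L ^ (-(1 / 2) : ℝ) := by positivity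
  linarith

/-- The four terms of the `O`-family at `⌊L⌋` are at most twice those at the real `L ≥ 1`.
[folklore] -/
theorem BC_T4_floor_le {L : ℝ} (hL : 1 ≤ L) {b : ℕ} (hb : 0 < b) {M N' : ℝ} (hM : 0 < M)
    (hN : 0 < N') :
    (M ^ 2 / ((⌊L⌋₊ : ℕ) : ℝ) + (b : ℝ) ^ (1 / 2 : ℝ) * M * N' * ((⌊L⌋₊ : ℕ) : ℝ) ^ (-(1 / 2) : ℝ) +
            (b : ℝ) ^ (1 / 2 : ℝ) * ((⌊L⌋₊ : ℕ) : ℝ) * N' ^ (3 / 2 : ℝ) + (b : ℝ) ^ (1 / 2 : ℝ) * ((⌊L⌋₊ : ℕ) : ℝ) ^ (3 / 2 : ℝ) * N' ^ (7 / 4 : ℝ)) ≤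
    2 * (M ^ 2 / L + (b : ℝ) ^ (1 / 2 : ℝ) * M * N' * L ^ (-(1 / 2) : ℝ) +
            (b : ℝ) ^ (1 / 2 : ℝ) * L * N' ^ (3 / 2 : ℝ) + (b : ℝ) ^ (1 / 2 : ℝ) * L ^ (3 / 2 : ℝ) * N' ^ (7 / 4 : ℝ)) := by
  set L₁ : ℝ := ((⌊L⌋₊ : ℕ) : ℝ) with hL₁
  have hb0 : (0 : ℝ) < b := by exact_mod_cast hb
  have hL0 : 0 < L := by linarith
  have h1 : L₁ ≤ L := Nat.floor_le hL0.le
  have h2 : L < L₁ + 1 := Nat.lt_floor_add_one L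
  have h3 : (1 : ℝ) ≤ L₁ := by
    have : 1 ≤ ⌊L⌋₊ := (Nat.one_le_floor_iff _).mpr hL
    rw [hL₁]; exact_mod_cast this
  have hL₁0 : 0 < L₁ := by linarith
  have h4 : L ≤ 2 * L₁ := by linarith
  have hinv : 1 / L₁ ≤ 2 / L := by
    rw [div_le_div_iff₀ hL₁0 hL0]; linarith
  have hm12 : L₁ ^ (-(1 / 2) : ℝ) ≤ 2 * L ^ (-(1 / 2) : ℝ) := by
    have ha : L₁ ^ (-(1 / 2) : ℝ) ≤ (L / 2) ^ (-(1 / 2) : ℝ) :=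
      Real.rpow_le_rpow_of_nonpos (by positivity) (by linarith) (by norm_num)
    have hb' : (L / 2) ^ (-(1 / 2) : ℝ) = (1 / 2) ^ (-(1 / 2) : ℝ) * L ^ (-(1 / 2) : ℝ) := by
      rw [show L / 2 = (1 / 2) * L by ring, Real.mul_rpow (by norm_num) hL0.le]
    have hc : (1 / 2 : ℝ) ^ (-(1 / 2) : ℝ) ≤ 2 := by
      rw [Real.rpow_neg (by norm_num), ← Real.inv_rpow (by norm_num)]
      norm_num
      calc (2 : ℝ) ^ (1 / 2 : ℝ) ≤ 2 ^ (1 : ℝ) :=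
            Real.rpow_le_rpow_of_exponent_le (by norm_num) (by norm_num)
        _ = 2 := Real.rpow_one 2
    have hL12 : 0 ≤ L ^ (-(1 / 2) : ℝ) := Real.rpow_nonneg hL0.le _
    calc L₁ ^ (-(1 / 2) : ℝ) ≤ (1 / 2) ^ (-(1 / 2) : ℝ) * L ^ (-(1 / 2) : ℝ) := ha.trans (le_of_eq hb')
      _ ≤ 2 * L ^ (-(1 / 2) : ℝ) := mul_le_mul_of_nonneg_right hc hL12
  have h32 : L₁ ^ (3 / 2 : ℝ) ≤ L ^ (3 / 2 : ℝ) := Real.rpow_le_rpow hL₁0.le h1 (by norm_num)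
  have t1 : M ^ 2 / L₁ ≤ 2 * (M ^ 2 / L) := by
    have e1 : M ^ 2 / L₁ = M ^ 2 * (1 / L₁) := by field_simp
    have e2 : 2 * (M ^ 2 / L) = M ^ 2 * (2 / L) := by field_simp
    rw [e1, e2]
    exact mul_le_mul_of_nonneg_left hinv (by positivity)
  have t2 : (b : ℝ) ^ (1 / 2 : ℝ) * M * N' * L₁ ^ (-(1 / 2) : ℝ) ≤
      2 * ((b : ℝ) ^ (1 / 2 : ℝ) * M * N' * L ^ (-(1 / 2) : ℝ)) := by
    have h0 : 0 ≤ (b : ℝ) ^ (1 / 2 : ℝ) * M * N' := by positivity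
    calc (b : ℝ) ^ (1 / 2 : ℝ) * M * N' * L₁ ^ (-(1 / 2) : ℝ)
        ≤ (b : ℝ) ^ (1 / 2 : ℝ) * M * N' * (2 * L ^ (-(1 / 2) : ℝ)) := mul_le_mul_of_nonneg_left hm12 h0
      _ = 2 * ((b : ℝ) ^ (1 / 2 : ℝ) * M * N' * L ^ (-(1 / 2) : ℝ)) := by ring
  have t3 : (b : ℝ) ^ (1 / 2 : ℝ) * L₁ * N' ^ (3 / 2 : ℝ) ≤ 2 * ((b : ℝ) ^ (1 / 2 : ℝ) * L * N' ^ (3 / 2 : ℝ)) := by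
    have h0 : 0 ≤ (b : ℝ) ^ (1 / 2 : ℝ) := by positivity
    have h0' : 0 ≤ N' ^ (3 / 2 : ℝ) := by positivity
    have a : (b : ℝ) ^ (1 / 2 : ℝ) * L₁ * N' ^ (3 / 2 : ℝ) ≤ (b : ℝ) ^ (1 / 2 : ℝ) * L * N' ^ (3 / 2 : ℝ) :=
      mul_le_mul_of_nonneg_right (mul_le_mul_of_nonneg_left h1 h0) h0'
    have hnn : 0 ≤ (b : ℝ) ^ (1 / 2 : ℝ) * L * N' ^ (3 / 2 : ℝ) := by positivity
    linarith
  have t4 : (b : ℝ) ^ (1 / 2 : ℝ) * L₁ ^ (3 / 2 : ℝ) * N' ^ (7 / 4 : ℝ) ≤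
      2 * ((b : ℝ) ^ (1 / 2 : ℝ) * L ^ (3 / 2 : ℝ) * N' ^ (7 / 4 : ℝ)) := by
    have h0 : 0 ≤ (b : ℝ) ^ (1 / 2 : ℝ) := by positivity
    have h0' : 0 ≤ N' ^ (7 / 4 : ℝ) := by positivity
    have a : (b : ℝ) ^ (1 / 2 : ℝ) * L₁ ^ (3 / 2 : ℝ) * N' ^ (7 / 4 : ℝ) ≤
        (b : ℝ) ^ (1 / 2 : ℝ) * L ^ (3 / 2 : ℝ) * N' ^ (7 / 4 : ℝ) :=
      mul_le_mul_of_nonneg_right (mul_le_mul_of_nonneg_left h32 h0) h0'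
    have hnn : 0 ≤ (b : ℝ) ^ (1 / 2 : ℝ) * L ^ (3 / 2 : ℝ) * N' ^ (7 / 4 : ℝ) := by positivity
    linarith
  linarith [t1, t2, t3, t4]

/-- `MN' ≤ b^{1/2}L^{3/2}N'^{7/4} ≤` the four terms, for `L ≥ max(1, M)`, `N' ≥ 1`. [folklore] -/
theorem BC_MN_le_T4 {b : ℕ} (hb : 0 < b) {M N' L : ℝ} (hM : 0 < M) (hN1 : 1 ≤ N') (hL1 : 1 ≤ L)
    (hML : M ≤ L) :
    M * N' ≤ (M ^ 2 / L + (b : ℝ) ^ (1 / 2 : ℝ) * M * N' * L ^ (-(1 / 2) : ℝ) +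
            (b : ℝ) ^ (1 / 2 : ℝ) * L * N' ^ (3 / 2 : ℝ) + (b : ℝ) ^ (1 / 2 : ℝ) * L ^ (3 / 2 : ℝ) * N' ^ (7 / 4 : ℝ)) := by
  have hbr : (1 : ℝ) ≤ b := by exact_mod_cast hb
  have hN0 : 0 < N' := by linarith
  have hL0 : 0 < L := by linarith
  have e1 : (1 : ℝ) ≤ (b : ℝ) ^ (1 / 2 : ℝ) := Real.one_le_rpow hbr (by norm_num)
  have e2 : M ≤ L ^ (3 / 2 : ℝ) := by
    calc M ≤ L := hML
      _ = L ^ (1 : ℝ) := (Real.rpow_one L).symm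
      _ ≤ L ^ (3 / 2 : ℝ) := Real.rpow_le_rpow_of_exponent_le hL1 (by norm_num)
  have e3 : N' ≤ N' ^ (7 / 4 : ℝ) := by
    calc N' = N' ^ (1 : ℝ) := (Real.rpow_one N').symm
      _ ≤ N' ^ (7 / 4 : ℝ) := Real.rpow_le_rpow_of_exponent_le hN1 (by norm_num)
  have e4 : M * N' ≤ L ^ (3 / 2 : ℝ) * N' ^ (7 / 4 : ℝ) := mul_le_mul e2 e3 hN0.le (by positivity)
  have e5 : M * N' ≤ (b : ℝ) ^ (1 / 2 : ℝ) * L ^ (3 / 2 : ℝ) * N' ^ (7 / 4 : ℝ) := by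
    calc M * N' ≤ 1 * (L ^ (3 / 2 : ℝ) * N' ^ (7 / 4 : ℝ)) := by rw [one_mul]; exact e4
      _ ≤ (b : ℝ) ^ (1 / 2 : ℝ) * (L ^ (3 / 2 : ℝ) * N' ^ (7 / 4 : ℝ)) :=
          mul_le_mul_of_nonneg_right e1 (by positivity)
      _ = (b : ℝ) ^ (1 / 2 : ℝ) * L ^ (3 / 2 : ℝ) * N' ^ (7 / 4 : ℝ) := by ring
  have a1 : 0 ≤ M ^ 2 / L := by positivity
  have a2 : 0 ≤ (b : ℝ) ^ (1 / 2 : ℝ) * M * N' * L ^ (-(1 / 2) : ℝ) := by positivity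
  have a3 : 0 ≤ (b : ℝ) ^ (1 / 2 : ℝ) * L * N' ^ (3 / 2 : ℝ) := by positivity
  linarith

/-! ### The amplified case at an integer `L₁ ≤ M` -/

set_option maxHeartbeats 800000 in
/-- **(2.2)+(3.2)+`O`-shape ⟹ (5.1'') at an admissible integer `L₁ ≤ M`** (as `BC_amplified_51`,
with the `O`-shape off-diagonal hypothesis at the amplifier `𝓛 = {ℓ ∈ (L₁,2L₁] prime, (ℓ,bk)=1}`).
[cite: BettinChandee2018, §2 (2.2), §5 (5.1)] -/
theorem BC_amplifiedO_51 {ε δ C₁ K : ℝ} (hδ0 : 0 < δ) (hδ1 : δ ≤ 1) (hδε : δ ≤ ε / 16)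
    (hC₁1 : 1 ≤ C₁) (hC₁ : ∀ n : ℕ, n ≠ 0 → ((n.divisors.card : ℕ) : ℝ) ≤ C₁ * (n : ℝ) ^ δ)
    (hK : 0 < K) {L₀ : ℕ}
    (hL₀ : ∀ L : ℕ, L₀ ≤ L →
      (L : ℝ) / (2 * Real.log L) ≤ (((Ioc L (2 * L)).filter Nat.Prime).card : ℝ))
    {b : ℕ} (hb : 0 < b) {M N' : ℝ} (hM : 1 / 2 ≤ M) (hN1 : 1 ≤ N') {k : ℤ} (hk : k ≠ 0)
    (hbk : b.Coprime k.natAbs) {γ : ℕ → ℂ} (hγ : ∀ n, γ n ≠ 0 → N' < n ∧ (n : ℝ) ≤ 2 * N')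
    (hγk : ∀ n, γ n ≠ 0 → n.Coprime k.natAbs) {L₁ : ℕ} (hL₁L₀ : L₀ ≤ L₁) (hL₁2 : 2 ≤ L₁)
    (hL₁M : (L₁ : ℝ) ≤ M) (h4log : 4 * Real.log (2 * ((b : ℝ) * M * N' * (1 + |(k : ℝ)|))) ≤ L₁)
    (hoffL : ‖∑ m ∈ (Ioc ⌊M⌋₊ ⌊2 * M⌋₊).filter (fun m => m.Coprime b), kfOff k b N' γ
        ((Ioc L₁ (2 * L₁)).filter (fun ℓ => ℓ.Prime ∧ ℓ.Coprime b ∧ ℓ.Coprime k.natAbs)) m‖ ≤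
      K * (∑ n ∈ Icc 1 ⌊2 * N'⌋₊, ‖γ n‖ ^ 2) * ((b : ℝ) * M * N' * (1 + |(k : ℝ)|)) ^ (ε / 2) *
        (1 + |(k : ℝ)| / ((b : ℝ) * N' * M)) ^ (1 / 2 : ℝ) *
        ((L₁ : ℝ) * N' + (L₁ : ℝ) * M + (b : ℝ) ^ (1 / 2 : ℝ) * (L₁ : ℝ) ^ (3 / 2 : ℝ) * N' +
          (b : ℝ) ^ (1 / 2 : ℝ) * (L₁ : ℝ) ^ (3 : ℝ) * N' ^ (3 / 2 : ℝ) * M⁻¹ +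
          (b : ℝ) ^ (1 / 2 : ℝ) * (L₁ : ℝ) ^ (7 / 2 : ℝ) * N' ^ (7 / 4 : ℝ) * M⁻¹)) :
    ∑ m ∈ (Ioc ⌊M⌋₊ ⌊2 * M⌋₊).filter (fun m => m.Coprime b), ‖kfInner k b N' γ m‖ ^ 2 ≤
      2 * (40000 * C₁ ^ 2 * (1 + 1 / δ) / δ ^ 3 + 64 * K / δ ^ 2) * (∑ n ∈ Icc 1 ⌊2 * N'⌋₊, ‖γ n‖ ^ 2) *
        ((b : ℝ) * M * N' * (1 + |(k : ℝ)|)) ^ ε * (1 + |(k : ℝ)| / ((b : ℝ) * N' * M)) ^ (1 / 2 : ℝ) *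
        (M ^ 2 / (L₁ : ℝ) + (b : ℝ) ^ (1 / 2 : ℝ) * M * N' * (L₁ : ℝ) ^ (-(1 / 2) : ℝ) +
            (b : ℝ) ^ (1 / 2 : ℝ) * (L₁ : ℝ) * N' ^ (3 / 2 : ℝ) + (b : ℝ) ^ (1 / 2 : ℝ) * (L₁ : ℝ) ^ (3 / 2 : ℝ) * N' ^ (7 / 4 : ℝ)) := by
  have hbr : (1 : ℝ) ≤ b := by exact_mod_cast hb
  have hb0 : (0 : ℝ) < b := by linarith
  have hM0 : 0 < M := by linarith
  have hN0 : 0 < N' := by linarith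
  have hk1 : (1 : ℝ) ≤ |(k : ℝ)| := by
    rw [← Int.cast_abs]; exact_mod_cast Int.one_le_abs hk
  have hL₁r2 : (2 : ℝ) ≤ L₁ := by exact_mod_cast hL₁2
  have hL₁0 : (0 : ℝ) < L₁ := by linarith
  have hlogL₁ : 0 < Real.log L₁ := Real.log_pos (by linarith)
  have hS0 : 0 ≤ (∑ n ∈ Icc 1 ⌊2 * N'⌋₊, ‖γ n‖ ^ 2) := Finset.sum_nonneg fun _ _ => sq_nonneg _
  have hbN1 : (1 : ℝ) ≤ b * N' := by nlinarith
  have hx1 : 1 ≤ ((b : ℝ) * M * N' * (1 + |(k : ℝ)|)) := by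
    have h2 : (1 : ℝ) * (1 / 2) * 2 ≤ ((b : ℝ) * N') * M * (1 + |(k : ℝ)|) := by gcongr; linarith
    nlinarith
  have hx0 : 0 < ((b : ℝ) * M * N' * (1 + |(k : ℝ)|)) := by linarith
  have hW1 : 1 ≤ (1 + |(k : ℝ)| / ((b : ℝ) * N' * M)) ^ (1 / 2 : ℝ) := Real.one_le_rpow (by
    have : 0 ≤ |(k : ℝ)| / ((b : ℝ) * N' * M) := by positivity
    linarith) (by norm_num)
  have hW0 : 0 ≤ (1 + |(k : ℝ)| / ((b : ℝ) * N' * M)) ^ (1 / 2 : ℝ) := by linarith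
  -- the amplifier
  have hP0 : 0 < (L₁ : ℝ) / (4 * Real.log L₁) := by positivity
  have hP𝓛 : ∀ m ∈ (Ioc ⌊M⌋₊ ⌊2 * M⌋₊).filter (fun m => m.Coprime b),
      (L₁ : ℝ) / (4 * Real.log L₁) ≤
        ((((Ioc L₁ (2 * L₁)).filter (fun ℓ => ℓ.Prime ∧ ℓ.Coprime b ∧ ℓ.Coprime k.natAbs)).filter (fun ℓ => ℓ.Coprime m)).card : ℝ) := by
    intro m hm
    rw [Finset.mem_filter, Finset.mem_Ioc] at hm
    have hm0 : 0 < m := by omega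
    have hm2 : (m : ℝ) ≤ 2 * M := by
      calc (m : ℝ) ≤ ⌊2 * M⌋₊ := by exact_mod_cast hm.1.2
        _ ≤ 2 * M := Nat.floor_le (by linarith)
    refine BC_card_amplifier_ge hL₀ hL₁L₀ hL₁2 hb hm0 hk ?_
    have hprod_pos : (0 : ℝ) < ((b * k.natAbs * m : ℕ) : ℝ) := by
      have : 0 < b * k.natAbs * m := by
        have : 0 < k.natAbs := Int.natAbs_pos.mpr hk
        positivity
      exact_mod_cast this
    have hle := BC_bkm_le_two_x (b := b) (k := k) hN1 hm2
    calc Real.log ((b * k.natAbs * m : ℕ) : ℝ) ≤ Real.log (2 * ((b : ℝ) * M * N' * (1 + |(k : ℝ)|))) :=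
          Real.log_le_log hprod_pos hle
      _ ≤ (L₁ : ℝ) / 4 := by linarith
  have hamp := kfCI_le_diag_add_off k b M N' γ
    ((Ioc L₁ (2 * L₁)).filter (fun ℓ => ℓ.Prime ∧ ℓ.Coprime b ∧ ℓ.Coprime k.natAbs)) hP0 hP𝓛
  have hPe : 2 * M / ((L₁ : ℝ) / (4 * Real.log L₁)) ^ 2 = 32 * M * Real.log L₁ ^ 2 / (L₁ : ℝ) ^ 2 := by
    field_simp
    ring
  rw [hPe] at hamp
  have hdiag := BC_diag_51 hδ0 hδ1 hC₁1 hC₁ hb hM hN1 hk hbk hγ hγk hL₁2 hL₁M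
  have hoff := BC_offO_51 hδ0 hb hM hN1 hk hL₁2 hL₁M (ε / 2) hK.le hS0 hW0 (K := K)
    (S₂ := (∑ n ∈ Icc 1 ⌊2 * N'⌋₊, ‖γ n‖ ^ 2)) (W := (1 + |(k : ℝ)| / ((b : ℝ) * N' * M)) ^ (1 / 2 : ℝ))
  have hF0 : 0 ≤ 32 * M * Real.log L₁ ^ 2 / (L₁ : ℝ) ^ 2 := by positivity
  have hdT := BC_diag_terms_le_T4 hb hM0 hN1 hL₁0 (M := M) (N' := N')
  -- exponents
  have he1 : ((b : ℝ) * M * N' * (1 + |(k : ℝ)|)) ^ (6 * δ) ≤ ((b : ℝ) * M * N' * (1 + |(k : ℝ)|)) ^ ε :=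
    Real.rpow_le_rpow_of_exponent_le hx1 (by linarith)
  have he2 : ((b : ℝ) * M * N' * (1 + |(k : ℝ)|)) ^ (ε / 2 + 2 * δ) ≤ ((b : ℝ) * M * N' * (1 + |(k : ℝ)|)) ^ ε :=
    Real.rpow_le_rpow_of_exponent_le hx1 (by linarith)
  -- names
  set x : ℝ := ((b : ℝ) * M * N' * (1 + |(k : ℝ)|)) with hx
  set Wr : ℝ := (1 + |(k : ℝ)| / ((b : ℝ) * N' * M)) ^ (1 / 2 : ℝ) with hWr
  set S₂ : ℝ := (∑ n ∈ Icc 1 ⌊2 * N'⌋₊, ‖γ n‖ ^ 2) with hS₂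
  set F : ℝ := 32 * M * Real.log L₁ ^ 2 / (L₁ : ℝ) ^ 2 with hF
  set Dn : ℝ := ‖∑ m ∈ (Ioc ⌊M⌋₊ ⌊2 * M⌋₊).filter (fun m => m.Coprime b), kfDiag k b N' γ
        ((Ioc L₁ (2 * L₁)).filter (fun ℓ => ℓ.Prime ∧ ℓ.Coprime b ∧ ℓ.Coprime k.natAbs)) m‖ with hDn
  set On : ℝ := ‖∑ m ∈ (Ioc ⌊M⌋₊ ⌊2 * M⌋₊).filter (fun m => m.Coprime b), kfOff k b N' γ
        ((Ioc L₁ (2 * L₁)).filter (fun ℓ => ℓ.Prime ∧ ℓ.Coprime b ∧ ℓ.Coprime k.natAbs)) m‖ with hOn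
  set D3 : ℝ := (M * ((b : ℝ) * N') ^ (1 / 2 : ℝ) * (L₁ : ℝ) ^ (-(1 / 2) : ℝ) + M ^ 2 / ((b : ℝ) * L₁ * N') + M ^ 2 / L₁) with hD3
  set Q : ℝ := ((L₁ : ℝ) * N' + (L₁ : ℝ) * M + (b : ℝ) ^ (1 / 2 : ℝ) * (L₁ : ℝ) ^ (3 / 2 : ℝ) * N' +
          (b : ℝ) ^ (1 / 2 : ℝ) * (L₁ : ℝ) ^ (3 : ℝ) * N' ^ (3 / 2 : ℝ) * M⁻¹ +
          (b : ℝ) ^ (1 / 2 : ℝ) * (L₁ : ℝ) ^ (7 / 2 : ℝ) * N' ^ (7 / 4 : ℝ) * M⁻¹) with hQ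
  set T : ℝ := (M ^ 2 / (L₁ : ℝ) + (b : ℝ) ^ (1 / 2 : ℝ) * M * N' * (L₁ : ℝ) ^ (-(1 / 2) : ℝ) +
            (b : ℝ) ^ (1 / 2 : ℝ) * (L₁ : ℝ) * N' ^ (3 / 2 : ℝ) + (b : ℝ) ^ (1 / 2 : ℝ) * (L₁ : ℝ) ^ (3 / 2 : ℝ) * N' ^ (7 / 4 : ℝ)) with hT
  set Cd : ℝ := 40000 * C₁ ^ 2 * (1 + 1 / δ) / δ ^ 3 with hCd
  have hCd0 : 0 < Cd := by positivity
  have hD30 : 0 ≤ D3 := by positivity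
  have hT0 : 0 ≤ T := by positivity
  have hxε0 : 0 ≤ x ^ ε := by positivity
  -- Step 1
  have h1 : ∑ m ∈ (Ioc ⌊M⌋₊ ⌊2 * M⌋₊).filter (fun m => m.Coprime b), ‖kfInner k b N' γ m‖ ^ 2 ≤
      F * Dn + F * (K * S₂ * x ^ (ε / 2) * Wr * Q) := by
    have := mul_le_mul_of_nonneg_left hoffL hF0
    calc ∑ m ∈ (Ioc ⌊M⌋₊ ⌊2 * M⌋₊).filter (fun m => m.Coprime b), ‖kfInner k b N' γ m‖ ^ 2 ≤ F * (Dn + On) := hamp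
      _ = F * Dn + F * On := by ring
      _ ≤ F * Dn + F * (K * S₂ * x ^ (ε / 2) * Wr * Q) := by linarith
  -- Step 2
  have h2 : F * Dn + F * (K * S₂ * x ^ (ε / 2) * Wr * Q) ≤
      Cd * S₂ * x ^ (6 * δ) * D3 + 64 * K / δ ^ 2 * S₂ * x ^ (ε / 2 + 2 * δ) * Wr * T :=
    add_le_add hdiag hoff
  -- Step 3
  have i1 : Cd * S₂ * x ^ (6 * δ) * D3 ≤ Cd * S₂ * x ^ ε * Wr * (2 * T) := by
    have : x ^ (6 * δ) ≤ x ^ ε * Wr := he1.trans (le_mul_of_one_le_right hxε0 hW1)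
    calc Cd * S₂ * x ^ (6 * δ) * D3 = (Cd * S₂) * (x ^ (6 * δ) * D3) := by ring
      _ ≤ (Cd * S₂) * ((x ^ ε * Wr) * (2 * T)) :=
          mul_le_mul_of_nonneg_left (mul_le_mul this hdT hD30 (by positivity)) (by positivity)
      _ = Cd * S₂ * x ^ ε * Wr * (2 * T) := by ring
  have i2 : 64 * K / δ ^ 2 * S₂ * x ^ (ε / 2 + 2 * δ) * Wr * T ≤
      64 * K / δ ^ 2 * S₂ * x ^ ε * Wr * T := by
    calc 64 * K / δ ^ 2 * S₂ * x ^ (ε / 2 + 2 * δ) * Wr * T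
        = (64 * K / δ ^ 2 * S₂ * Wr * T) * x ^ (ε / 2 + 2 * δ) := by ring
      _ ≤ (64 * K / δ ^ 2 * S₂ * Wr * T) * x ^ ε := mul_le_mul_of_nonneg_left he2 (by positivity)
      _ = 64 * K / δ ^ 2 * S₂ * x ^ ε * Wr * T := by ring
  have i3 : Cd * S₂ * x ^ ε * Wr * (2 * T) + 64 * K / δ ^ 2 * S₂ * x ^ ε * Wr * T ≤
      2 * (Cd + 64 * K / δ ^ 2) * S₂ * x ^ ε * Wr * T := by
    have : 0 ≤ 64 * K / δ ^ 2 * S₂ * x ^ ε * Wr * T := by positivity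
    linarith
  calc ∑ m ∈ (Ioc ⌊M⌋₊ ⌊2 * M⌋₊).filter (fun m => m.Coprime b), ‖kfInner k b N' γ m‖ ^ 2
      ≤ Cd * S₂ * x ^ ε * Wr * (2 * T) + 64 * K / δ ^ 2 * S₂ * x ^ ε * Wr * T := by
        linarith [h1, h2, i1, i2]
    _ ≤ 2 * (Cd + 64 * K / δ ^ 2) * S₂ * x ^ ε * Wr * T := i3

/-! ### The main reduction: `O`-shape ⟹ (5.1'') for all admissible `L` -/

set_option maxHeartbeats 800000 in
/-- **From the `O`-shape off-diagonal bound to (2.2)+(5.1'') for every admissible `L`.**  Assume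
the off-diagonal bound in the shape produced by `kfO_le` (`KloostermanFractionsOffDiagO.lean`, in
`ε`-form, `BC_offO_of_kfO`): for squarefull `b` coprime to `k ≠ 0`, `M ≥ 1/2`, `N' ≥ b`, `γ`
supported on squarefree `n ∈ (N', 2N']` coprime to `bk`, `2 ≤ L ≤ M` and any set `𝓛` of primes
`ℓ ∈ (L, 2L]` coprime to `bk`,
`‖∑_{M<m≤2M,(m,b)=1} kfOff m‖ ≤ K ‖γ‖² x^ε (1+|k|/(bN'M))^{1/2} (LN' + LM + b^{1/2}L^{3/2}N' + b^{1/2}L³N'^{3/2}/M + b^{1/2}L^{7/2}N'^{7/4}/M)`.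
Then for every real `L ≥ Lmin(b, M, N', k)` (a threshold of logarithmic size),
`∑_{M<m≤2M,(m,b)=1} |kfInner m|² ≤ K' ‖γ‖² x^ε (1+|k|/(bN'M))^{1/2} (M²/L + b^{1/2}MN'L^{-1/2} + b^{1/2}LN'^{3/2} + b^{1/2}L^{3/2}N'^{7/4})`
(for `L ≤ M` by `BC_amplifiedO_51` at `⌊L⌋`, for `L > M` by the trivial bound).
[cite: BettinChandee2018, §2 (2.2), §3 (3.2), §4 (4.33), §5 (5.1)] -/
theorem BC_L_bound_of_offO
    (hoff : ∀ ε : ℝ, 0 < ε → ∃ K : ℝ, 0 < K ∧ ∀ (b : ℕ), 0 < b → (∀ p ∈ b.primeFactors, p ^ 2 ∣ b) →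
      ∀ (M N' : ℝ), 1 / 2 ≤ M → 1 / 2 ≤ N' → (b : ℝ) ≤ N' → ∀ (k : ℤ), k ≠ 0 → b.Coprime k.natAbs →
      ∀ (γ : ℕ → ℂ), (∀ n : ℕ, γ n ≠ 0 → N' < n ∧ (n : ℝ) ≤ 2 * N') →
        (∀ n : ℕ, γ n ≠ 0 → Squarefree n ∧ n.Coprime b ∧ n.Coprime k.natAbs) →
      ∀ (L : ℕ), 2 ≤ L → (L : ℝ) ≤ M → ∀ (𝓛 : Finset ℕ),
        (∀ ℓ ∈ 𝓛, ℓ.Prime ∧ L < ℓ ∧ ℓ ≤ 2 * L ∧ ℓ.Coprime b ∧ ℓ.Coprime k.natAbs) →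
        ‖∑ m ∈ (Ioc ⌊M⌋₊ ⌊2 * M⌋₊).filter (fun m => m.Coprime b), kfOff k b N' γ 𝓛 m‖ ≤
          K * (∑ n ∈ Icc 1 ⌊2 * N'⌋₊, ‖γ n‖ ^ 2) * ((b : ℝ) * M * N' * (1 + |(k : ℝ)|)) ^ ε *
            (1 + |(k : ℝ)| / ((b : ℝ) * N' * M)) ^ (1 / 2 : ℝ) *
            ((L : ℝ) * N' + (L : ℝ) * M + (b : ℝ) ^ (1 / 2 : ℝ) * (L : ℝ) ^ (3 / 2 : ℝ) * N' +
          (b : ℝ) ^ (1 / 2 : ℝ) * (L : ℝ) ^ (3 : ℝ) * N' ^ (3 / 2 : ℝ) * M⁻¹ +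
          (b : ℝ) ^ (1 / 2 : ℝ) * (L : ℝ) ^ (7 / 2 : ℝ) * N' ^ (7 / 4 : ℝ) * M⁻¹)) :
    ∃ Lmin : ℕ → ℝ → ℝ → ℤ → ℝ,
      (∃ C : ℝ, 0 ≤ C ∧ ∀ (b : ℕ) (M N' : ℝ) (k : ℤ), 0 < b → 1 / 2 ≤ M → 1 / 2 ≤ N' →
        Lmin b M N' k ≤ C * (1 + Real.log (1 + (b : ℝ) * M * N' * (1 + |(k : ℝ)|)))) ∧
      ∀ ε : ℝ, 0 < ε → ∃ K : ℝ, 0 < K ∧ ∀ (b : ℕ), 0 < b → (∀ p ∈ b.primeFactors, p ^ 2 ∣ b) →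
      ∀ (M N' : ℝ), 1 / 2 ≤ M → 1 / 2 ≤ N' → (b : ℝ) ≤ N' → ∀ (k : ℤ), k ≠ 0 → b.Coprime k.natAbs →
      ∀ (γ : ℕ → ℂ),
        (∀ n : ℕ, γ n ≠ 0 → N' < n ∧ (n : ℝ) ≤ 2 * N') →
        (∀ n : ℕ, γ n ≠ 0 → Squarefree n ∧ n.Coprime b ∧ n.Coprime k.natAbs) →
        ∀ L : ℝ, Lmin b M N' k ≤ L → 1 ≤ L →
        ∑ m ∈ (Ioc ⌊M⌋₊ ⌊2 * M⌋₊).filter (fun m => m.Coprime b), ‖kfInner k b N' γ m‖ ^ 2 ≤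
          K * (∑ n ∈ Icc 1 ⌊2 * N'⌋₊, ‖γ n‖ ^ 2) *
          ((b : ℝ) * M * N' * (1 + |(k : ℝ)|)) ^ ε * (1 + |(k : ℝ)| / ((b : ℝ) * N' * M)) ^ (1 / 2 : ℝ) *
          (M ^ 2 / L + (b : ℝ) ^ (1 / 2 : ℝ) * M * N' * L ^ (-(1 / 2) : ℝ) +
            (b : ℝ) ^ (1 / 2 : ℝ) * L * N' ^ (3 / 2 : ℝ) + (b : ℝ) ^ (1 / 2 : ℝ) * L ^ (3 / 2 : ℝ) * N' ^ (7 / 4 : ℝ)) := by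
  obtain ⟨L₀, hL₀⟩ := DFI_card_primes_Ioc_ge
  refine ⟨fun b M N' k => (L₀ : ℝ) + 3 + 4 * Real.log (2 * ((b : ℝ) * M * N' * (1 + |(k : ℝ)|))),
    ⟨(L₀ : ℝ) + 11, by positivity, ?_⟩, ?_⟩
  · intro b M N' k hb hM hN'
    have hbr : (1 : ℝ) ≤ b := by exact_mod_cast hb
    have hk0 : (0 : ℝ) ≤ |(k : ℝ)| := abs_nonneg _
    have hx0 : 0 < (b : ℝ) * M * N' * (1 + |(k : ℝ)|) := by positivity
    have h1 : Real.log (2 * ((b : ℝ) * M * N' * (1 + |(k : ℝ)|))) ≤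
        1 + Real.log (1 + (b : ℝ) * M * N' * (1 + |(k : ℝ)|)) := by
      rw [Real.log_mul (by norm_num) hx0.ne']
      have h2 : Real.log 2 ≤ 1 := by
        have := Real.log_two_lt_d9; linarith
      have h3 : Real.log ((b : ℝ) * M * N' * (1 + |(k : ℝ)|)) ≤
          Real.log (1 + (b : ℝ) * M * N' * (1 + |(k : ℝ)|)) := Real.log_le_log hx0 (by linarith)
      linarith
    have hlog0 : 0 ≤ Real.log (1 + (b : ℝ) * M * N' * (1 + |(k : ℝ)|)) := Real.log_nonneg (by linarith)
    have hL00 : (0 : ℝ) ≤ L₀ := by positivity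
    show (L₀ : ℝ) + 3 + 4 * Real.log (2 * ((b : ℝ) * M * N' * (1 + |(k : ℝ)|))) ≤
      ((L₀ : ℝ) + 11) * (1 + Real.log (1 + (b : ℝ) * M * N' * (1 + |(k : ℝ)|)))
    nlinarith
  intro ε hε
  set δ : ℝ := min (ε / 16) 1 with hδ
  have hδ0 : 0 < δ := lt_min (by positivity) one_pos
  have hδ1 : δ ≤ 1 := min_le_right _ _
  have hδε : δ ≤ ε / 16 := min_le_left _ _
  obtain ⟨C₁, hC₁1, hC₁⟩ :=
    Literature.NumberTheory.Sieve.exists_card_divisors_le_mul_rpow (ε := δ) hδ0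
  obtain ⟨K, hK, hO⟩ := hoff (ε / 2) (by positivity)
  have hCd0 : 0 < 40000 * C₁ ^ 2 * (1 + 1 / δ) / δ ^ 3 := by positivity
  have hc20 : 0 < 64 * K / δ ^ 2 := by positivity
  refine ⟨4 * (40000 * C₁ ^ 2 * (1 + 1 / δ) / δ ^ 3 + 64 * K / δ ^ 2) + 8, by positivity, ?_⟩
  intro b hb hbfull M N' hM hN' hbN k hk hbk γ hγ hγ2 L hLmin hL1
  have hbr : (1 : ℝ) ≤ b := by exact_mod_cast hb
  have hb0 : (0 : ℝ) < b := by linarith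
  have hM0 : 0 < M := by linarith
  have hN1 : 1 ≤ N' := hbr.trans hbN
  have hN0 : 0 < N' := by linarith
  have hk1 : (1 : ℝ) ≤ |(k : ℝ)| := by
    rw [← Int.cast_abs]; exact_mod_cast Int.one_le_abs hk
  have hL0 : 0 < L := by linarith
  have hS0 : 0 ≤ (∑ n ∈ Icc 1 ⌊2 * N'⌋₊, ‖γ n‖ ^ 2) := Finset.sum_nonneg fun _ _ => sq_nonneg _
  have hbN1 : (1 : ℝ) ≤ b * N' := by nlinarith
  have hx1 : 1 ≤ ((b : ℝ) * M * N' * (1 + |(k : ℝ)|)) := by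
    have h2 : (1 : ℝ) * (1 / 2) * 2 ≤ ((b : ℝ) * N') * M * (1 + |(k : ℝ)|) := by gcongr; linarith
    nlinarith
  have hx0 : 0 < ((b : ℝ) * M * N' * (1 + |(k : ℝ)|)) := by linarith
  have hW1 : 1 ≤ (1 + |(k : ℝ)| / ((b : ℝ) * N' * M)) ^ (1 / 2 : ℝ) := Real.one_le_rpow (by
    have : 0 ≤ |(k : ℝ)| / ((b : ℝ) * N' * M) := by positivity
    linarith) (by norm_num)
  have hxε1 : 1 ≤ ((b : ℝ) * M * N' * (1 + |(k : ℝ)|)) ^ ε := Real.one_le_rpow hx1 hε.le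
  have hT0 : 0 ≤ (M ^ 2 / L + (b : ℝ) ^ (1 / 2 : ℝ) * M * N' * L ^ (-(1 / 2) : ℝ) +
            (b : ℝ) ^ (1 / 2 : ℝ) * L * N' ^ (3 / 2 : ℝ) + (b : ℝ) ^ (1 / 2 : ℝ) * L ^ (3 / 2 : ℝ) * N' ^ (7 / 4 : ℝ)) := by positivity
  have hγk : ∀ n, γ n ≠ 0 → n.Coprime k.natAbs := fun n hn => (hγ2 n hn).2.2
  set Kf : ℝ := 4 * (40000 * C₁ ^ 2 * (1 + 1 / δ) / δ ^ 3 + 64 * K / δ ^ 2) + 8 with hKf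
  set T : ℝ := (M ^ 2 / L + (b : ℝ) ^ (1 / 2 : ℝ) * M * N' * L ^ (-(1 / 2) : ℝ) +
            (b : ℝ) ^ (1 / 2 : ℝ) * L * N' ^ (3 / 2 : ℝ) + (b : ℝ) ^ (1 / 2 : ℝ) * L ^ (3 / 2 : ℝ) * N' ^ (7 / 4 : ℝ)) with hT
  set S₂ : ℝ := (∑ n ∈ Icc 1 ⌊2 * N'⌋₊, ‖γ n‖ ^ 2) with hS₂
  set xe : ℝ := ((b : ℝ) * M * N' * (1 + |(k : ℝ)|)) ^ ε with hxe
  set Wr : ℝ := (1 + |(k : ℝ)| / ((b : ℝ) * N' * M)) ^ (1 / 2 : ℝ) with hWr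
  have hfin : ∀ B : ℝ, ∑ m ∈ (Ioc ⌊M⌋₊ ⌊2 * M⌋₊).filter (fun m => m.Coprime b), ‖kfInner k b N' γ m‖ ^ 2 ≤ B →
      B ≤ Kf * S₂ * xe * Wr * T →
      ∑ m ∈ (Ioc ⌊M⌋₊ ⌊2 * M⌋₊).filter (fun m => m.Coprime b), ‖kfInner k b N' γ m‖ ^ 2 ≤ Kf * S₂ * xe * Wr * T := fun B h1 h2 => h1.trans h2
  have hKf8 : 8 ≤ Kf := by rw [hKf]; linarith
  have hprod1 : 1 ≤ xe * Wr := by nlinarith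
  by_cases hLM : M < L
  · -- Case 1: `L > M`
    have htriv := kfCI_trivial_bound k b hM0.le hN0.le γ
    have hMN := BC_MN_le_T4 hb hM0 hN1 hL1 hLM.le
    refine hfin _ htriv ?_
    have a : M * N' * S₂ ≤ T * S₂ := mul_le_mul_of_nonneg_right hMN hS0
    have c : T * S₂ ≤ T * S₂ * (xe * Wr) := le_mul_of_one_le_right (by positivity) hprod1
    have d : 0 ≤ T * S₂ * (xe * Wr) := by positivity
    calc 4 * M * N' * S₂ = 4 * (M * N' * S₂) := by ring
      _ ≤ 4 * (T * S₂ * (xe * Wr)) := by linarith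
      _ ≤ Kf * (T * S₂ * (xe * Wr)) := mul_le_mul_of_nonneg_right (by linarith) d
      _ = Kf * S₂ * xe * Wr * T := by ring
  -- Case 2: `L ≤ M`
  push Not at hLM
  have hL₁L : ((⌊L⌋₊ : ℕ) : ℝ) ≤ L := Nat.floor_le hL0.le
  have hLL₁ : L < ((⌊L⌋₊ : ℕ) : ℝ) + 1 := Nat.lt_floor_add_one L
  have hL₁M : ((⌊L⌋₊ : ℕ) : ℝ) ≤ M := hL₁L.trans hLM
  have hlog2x : 0 ≤ Real.log (2 * ((b : ℝ) * M * N' * (1 + |(k : ℝ)|))) := Real.log_nonneg (by linarith)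
  have hthr : (L₀ : ℝ) + 3 + 4 * Real.log (2 * ((b : ℝ) * M * N' * (1 + |(k : ℝ)|))) ≤ L := hLmin
  have hL00 : (0 : ℝ) ≤ L₀ := by positivity
  have hL₁L₀ : L₀ ≤ ⌊L⌋₊ := by
    have : (L₀ : ℝ) < ((⌊L⌋₊ : ℕ) : ℝ) := by linarith
    exact_mod_cast this.le
  have hL₁2 : 2 ≤ ⌊L⌋₊ := by
    have : (2 : ℝ) < ((⌊L⌋₊ : ℕ) : ℝ) := by linarith
    exact_mod_cast this.le
  have h4log : 4 * Real.log (2 * ((b : ℝ) * M * N' * (1 + |(k : ℝ)|))) ≤ ((⌊L⌋₊ : ℕ) : ℝ) := by linarith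
  have h𝓛 : ∀ ℓ ∈ ((Ioc ⌊L⌋₊ (2 * ⌊L⌋₊)).filter (fun ℓ => ℓ.Prime ∧ ℓ.Coprime b ∧ ℓ.Coprime k.natAbs)),
      ℓ.Prime ∧ ⌊L⌋₊ < ℓ ∧ ℓ ≤ 2 * ⌊L⌋₊ ∧ ℓ.Coprime b ∧ ℓ.Coprime k.natAbs := by
    intro ℓ hℓ
    rw [Finset.mem_filter, Finset.mem_Ioc] at hℓ
    exact ⟨hℓ.2.1, hℓ.1.1, hℓ.1.2, hℓ.2.2.1, hℓ.2.2.2⟩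
  have hoffL := hO b hb hbfull M N' hM hN' hbN k hk hbk γ hγ hγ2 ⌊L⌋₊ hL₁2 hL₁M _ h𝓛
  have hmain := BC_amplifiedO_51 hδ0 hδ1 hδε hC₁1 hC₁ hK hL₀ hb hM hN1 hk hbk hγ hγk hL₁L₀ hL₁2
    hL₁M h4log hoffL
  have hfl := BC_T4_floor_le hL1 hb hM0 hN0 (M := M) (N' := N')
  refine hfin _ hmain ?_
  rw [← hS₂, ← hxe, ← hWr] at hmain ⊢
  set T₁ : ℝ := (M ^ 2 / ((⌊L⌋₊ : ℕ) : ℝ) + (b : ℝ) ^ (1 / 2 : ℝ) * M * N' * ((⌊L⌋₊ : ℕ) : ℝ) ^ (-(1 / 2) : ℝ) +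
            (b : ℝ) ^ (1 / 2 : ℝ) * ((⌊L⌋₊ : ℕ) : ℝ) * N' ^ (3 / 2 : ℝ) + (b : ℝ) ^ (1 / 2 : ℝ) * ((⌊L⌋₊ : ℕ) : ℝ) ^ (3 / 2 : ℝ) * N' ^ (7 / 4 : ℝ)) with hT₁
  have hc0 : 0 ≤ 2 * (40000 * C₁ ^ 2 * (1 + 1 / δ) / δ ^ 3 + 64 * K / δ ^ 2) * S₂ * xe * Wr := by
    positivity
  have hT8 : 0 ≤ 8 * S₂ * xe * Wr * T := by positivity
  calc 2 * (40000 * C₁ ^ 2 * (1 + 1 / δ) / δ ^ 3 + 64 * K / δ ^ 2) * S₂ * xe * Wr * T₁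
      ≤ 2 * (40000 * C₁ ^ 2 * (1 + 1 / δ) / δ ^ 3 + 64 * K / δ ^ 2) * S₂ * xe * Wr * (2 * T) :=
        mul_le_mul_of_nonneg_left hfl hc0
    _ ≤ 2 * (40000 * C₁ ^ 2 * (1 + 1 / δ) / δ ^ 3 + 64 * K / δ ^ 2) * S₂ * xe * Wr * (2 * T) +
        8 * S₂ * xe * Wr * T := by linarith
    _ = Kf * S₂ * xe * Wr * T := by rw [hKf]; ring

end Literature.NumberTheory.LFunctions

end
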